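import Literature.Geometry.GeometricMeasureTheory.CurrentsAdmissiblePushforward
import HarnessLib

/-!
# The admissible push-forward (Federer 4.2.2), part II: homotopies, boundary, homotopy formula

Support file for the proof of the named fact
`Literature.Geometry.GeometricMeasureTheory.Federer1969_compactness_integralCurrents`
(Federer–Fleming compactness, [Federer1969, 4.2.17 (2)]), continuing
`CurrentsAdmissiblePushforward.lean` (the push-forward `g_{#v} S = lim_r (G_r)_# (S ⌞ {v > r})`).
This file completes the statement of Federer 4.2.2 in our Lipschitz framework:

* **Homotopies along Lipschitz maps** (4.1.9 for Lipschitz `F, G` with `‖G − F‖ ≤ η`):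
  `𝐌([0,1] × T) ≤ 𝐌(T)`, `𝐌(δ_t × T) ≤ 𝐌(T)`, `𝐌(∂([0,1] × T)) ≤ 2𝐌(T) + 𝐌(∂T)`
  (`Current.mass_prodInterval_le`, …); the clamped affine homotopy `lipHomotopyMap F G` (globally
  Lipschitz, `= f + t(g − f)` on `[−2, 2] × E`); `Current.lipHomotopy T … = Φ_# ([0,1] × T)`;
  **the homotopy formula `G_# T − F_# T = ∂ H(F,G) T + H(F,G) ∂T`**
  (`Current.lipPushforward_sub_lipPushforward_eq`, degree `≥ 2`, from the smooth formula
  `Current.homotopy_formula_affine` along the smooth approximants, using the cutoff-general closeness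
  estimate `Current.abs_lipPushforward_sub_pushforward_le'`) and the mass bound
  `𝐌(H(F,G) T) ≤ η (5 max(Lip F, Lip G))^{m+1} 𝐌(T)` (`Current.mass_lipHomotopy_le`);
* **the admissible homotopy `H_v(g₁, g₂) S`** (`Current.admHomLim`): pair extensions
  `(G¹_r, G²_r)` with `‖G² − G¹‖ ≤ √n η₀` everywhere (`Admissible.exists_ext_pair`, a bounded Lipschitz
  extension of `g₂ − g₁`), the shell family `Current.admHomFamily` and its limit, with
  `𝐌(H_v S) ≤ (√n η₀) 15^{d+1} (8C√n)^{d+1} ∫ (1/v)^{d+1} d‖S‖` (`Current.mass_admHomLim_le`);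
* **good sequences with slice decay** (`Current.exists_goodSeq_decay`): radii `r_j` with
  `(extConst r_j)^{d+1} 𝐌⟨S, v, r_j+⟩ → 0`, selected by Markov's inequality from a measurable
  majorant of the slice masses (`Current.IsRepresentable.exists_measurable_slice_majorant`) and the
  weighted bound `‖S‖{v ≤ c} ≤ c^{d+2} ∫_{v ≤ c} (1/v)^{d+2} d‖S‖`
  [Federer: "`lim inf_{r→0+} r^{1−m} 𝐌⟨T, u, r+⟩ = 0`"];
* **`∂ (g_{#v} S) = g_{#v} (∂S)`** (`Current.boundary_admPushLim`) and **the homotopy formula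
  `g₂{#v} S − g₁{#v} S = ∂ H_v(g₁,g₂) S + H_v(g₁,g₂) ∂S`** (`Current.admPushLim_sub_admPushLim_eq`),
  both for `S` of degree `≥ 2` and any good sequences;
* **independence of the control function** (`Current.admPushLim_control_eq`): `g_{#v} S = g_{#v'} S`
  for `v ≤ v'` both admissible (used with `v = u_m ∘ τ_a ≤ u_{m-1} ∘ τ_a`-type controls in 4.2.9).

## References

* H. Federer, *Geometric Measure Theory*, Springer 1969, 4.1.9, 4.1.14, 4.2.1–4.2.2 (held copy
  `lit book:federernd-geometric-measure-theory`, PDF pp. 318–320, 326, 334–337) [Federer1969].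
-/

noncomputable section

open scoped Distributions ENNReal NNReal Topology ContDiff InnerProductSpace
open MeasureTheory TopologicalSpace Set Filter Metric Function Module

namespace Literature.Geometry.GeometricMeasureTheory

-- Nested operator-norm instances on (duals of) `E [⋀^Fin m]→L[ℝ] ℝ`.
set_option maxSynthPendingDepth 2

/-! ## Homotopies along Lipschitz maps (Federer 4.1.9, 4.1.14) — Part D1 -/

section ProductNormal

variable {E : Type*} [NormedAddCommGroup E] [NormedSpace ℝ E] [FiniteDimensional ℝ E]
  {Ω : Opens E} {m : ℕ}

omit [FiniteDimensional ℝ E] in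
/-- **`spt ([a, b] × T)` is compact** when `spt T` is. [cite: Federer1969, 4.1.8] -/
theorem Current.isCompact_support_prodInterval (T : Current Ω m) (hT : IsCompact T.support) (a b : ℝ) :
    IsCompact (T.prodInterval a b).support :=
  Current.isCompact_support_of_subset _ (isCompact_uIcc.prod hT)
    (Set.prod_mono (Set.subset_univ _) T.support_subset |>.trans (by rw [coe_cylinder]))
    (T.support_prodInterval_subset a b)

/-- **`𝐌([0, 1] × T) ≤ 𝐌(T)`** for `spt T` compact (`[0,1] × T = id_#([0,1] × T)` and the mass bound
for push-forwards of products with `H = id`: `‖D id(e₀)‖ = 1`, `‖D id|_E‖ ≤ 1`).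
[cite: Federer1969, 4.1.8] -/
theorem Current.mass_prodInterval_le (T : Current Ω m) (hT : IsCompact T.support) :
    (T.prodInterval 0 1).mass ≤ T.mass := by
  have hc := T.isCompact_support_prodInterval hT 0 1
  obtain ⟨hUo, hTU, hχ1, hχabs⟩ := (T.prodInterval 0 1).cutoff_spec hc
  have hid := (T.prodInterval 0 1).pushforward_id ((T.prodInterval 0 1).cutoff hc) hUo hTU hχ1
  have hinr : ‖ContinuousLinearMap.inr ℝ ℝ E‖ ≤ 1 :=
    ContinuousLinearMap.opNorm_le_bound _ zero_le_one fun x => by simp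
  calc (T.prodInterval 0 1).mass
      = ((T.prodInterval 0 1).pushforward (cylinder Ω) ((T.prodInterval 0 1).cutoff hc)
          (contDiff_id (𝕜 := ℝ) (E := ℝ × E))).mass := by rw [hid]
    _ ≤ ENNReal.ofReal 1 * T.mass := by
        refine T.mass_pushforward_prodInterval_le _ contDiff_id zero_le_one fun p _ => ?_
        rw [fderiv_id, ContinuousLinearMap.coe_id', id_eq, ContinuousLinearMap.id_comp]
        calc |(T.prodInterval 0 1).cutoff hc p| * ‖timeVec E‖ * ‖ContinuousLinearMap.inr ℝ ℝ E‖ ^ m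
            ≤ 1 * 1 * 1 ^ m := by
              refine mul_le_mul (mul_le_mul (hχabs p) ?_ (norm_nonneg _) zero_le_one)
                (pow_le_pow_left₀ (norm_nonneg _) hinr m)
                (by positivity) (by positivity)
              unfold timeVec
              rw [Prod.norm_def, norm_one, norm_zero, max_eq_left zero_le_one]
          _ = 1 := by ring
    _ = T.mass := by rw [ENNReal.ofReal_one, one_mul]

omit [FiniteDimensional ℝ E] in
/-- **`𝐌(δ_t × T) ≤ 𝐌(T)`** (`(δ_t × T)(φ) = T(j_t^* φ)`, `‖j_t^* φ‖ ≤ ‖φ‖`). [cite: Federer1969, 4.1.8] -/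
theorem Current.mass_timesDirac_le (T : Current Ω (m + 1)) (t : ℝ) : (T.timesDirac t).mass ≤ T.mass := by
  have hinr : ‖ContinuousLinearMap.inr ℝ ℝ E‖ ≤ 1 :=
    ContinuousLinearMap.opNorm_le_bound _ zero_le_one fun x => by simp
  refine iSup₂_le fun φ hφ => ?_
  rw [Current.timesDirac_apply]
  refine le_iSup₂_of_le (TestForm.sliceBy (slicePullCLM E m) φ t) (fun x => ?_) le_rfl
  rw [TestForm.sliceBy_apply]
  calc ‖slicePullCLM E m (φ (t, x))‖
      ≤ ‖φ (t, x)‖ * ‖ContinuousLinearMap.inr ℝ ℝ E‖ ^ Fintype.card (Fin (m + 1)) :=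
        ContinuousAlternatingMap.norm_compContinuousLinearMap_le _ _
    _ ≤ 1 * 1 ^ Fintype.card (Fin (m + 1)) :=
        mul_le_mul (hφ _) (pow_le_pow_left₀ (norm_nonneg _) hinr _)
          (by positivity) zero_le_one
    _ = 1 := by ring

/-- **`𝐌(∂([0,1] × T)) ≤ 2 𝐌(T) + 𝐌(∂T)`** (`∂([0,1] × T) = δ₁ × T − δ₀ × T − [0,1] × ∂T`).
[cite: Federer1969, 4.1.8] -/
theorem Current.mass_boundary_prodInterval_le (T : Current Ω (m + 1)) (hT : IsCompact T.support) :
    (T.prodInterval 0 1).boundary.mass ≤ 2 * T.mass + T.boundary.mass := by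
  rw [T.boundary_prodInterval 0 1, sub_eq_add_neg, sub_eq_add_neg, two_mul]
  refine (Current.mass_add_le _ _).trans (add_le_add ((Current.mass_add_le _ _).trans
    (add_le_add (T.mass_timesDirac_le 1) ?_)) ?_)
  · rw [Current.mass_neg]; exact T.mass_timesDirac_le 0
  · rw [Current.mass_neg]
    exact T.boundary.mass_prodInterval_le (T.isCompact_support_boundary hT)

/-- Hence `𝐌([0,1] × T) < ∞` and `𝐌(∂([0,1] × T)) < ∞` for a normal `T` with compact support.
[cite: Federer1969, 4.1.8] -/
theorem Current.mass_prodInterval_ne_top (T : Current Ω m) (hT : IsCompact T.support) (hm : T.mass ≠ ⊤) :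
    (T.prodInterval 0 1).mass ≠ ⊤ :=
  ne_top_of_le_ne_top hm (T.mass_prodInterval_le hT)

/-- `𝐌(∂([0,1] × T)) < ∞` for a normal `T` with compact support. [cite: Federer1969, 4.1.8] -/
theorem Current.mass_boundary_prodInterval_ne_top (T : Current Ω (m + 1)) (hT : IsCompact T.support)
    (hm : T.mass ≠ ⊤) (hbm : T.boundary.mass ≠ ⊤) : (T.prodInterval 0 1).boundary.mass ≠ ⊤ :=
  ne_top_of_le_ne_top (ENNReal.add_ne_top.2 ⟨ENNReal.mul_ne_top (by simp) hm, hbm⟩)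
    (T.mass_boundary_prodInterval_le hT)

omit [FiniteDimensional ℝ E] in
/-- **Additivity of the product in the current.** [folklore] -/
theorem Current.prodInterval_add (S T : Current Ω m) (a b : ℝ) :
    (S + T).prodInterval a b = S.prodInterval a b + T.prodInterval a b := by
  ext φ
  rw [show (S.prodInterval a b + T.prodInterval a b) φ = S.prodInterval a b φ + T.prodInterval a b φ from rfl,
    Current.prodInterval_apply, Current.prodInterval_apply, Current.prodInterval_apply,
    ← intervalIntegral.integral_add (S.intervalIntegrable_apply_sliceBy _ φ a b)
      (T.intervalIntegrable_apply_sliceBy _ φ a b)]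
  rfl

omit [FiniteDimensional ℝ E] in
/-- **`[a,b] × (−T) = −([a,b] × T)`.** [folklore] -/
theorem Current.prodInterval_neg (T : Current Ω m) (a b : ℝ) :
    (-T).prodInterval a b = -T.prodInterval a b := by
  ext φ
  rw [show (-T.prodInterval a b) φ = -(T.prodInterval a b φ) from rfl,
    Current.prodInterval_apply, Current.prodInterval_apply, ← intervalIntegral.integral_neg]
  rfl

end ProductNormal

section HomotopyMap

variable {E E' : Type*} [NormedAddCommGroup E] [NormedSpace ℝ E]
  [NormedAddCommGroup E'] [NormedSpace ℝ E']

/-- **The clamped affine homotopy** `Φ(t, x) = F x + π(t) (G x − F x)` with `π` the projection of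
`ℝ` onto `[−2, 2]`: a globally Lipschitz map on `ℝ × E` equal to the affine homotopy
`f + t(g − f)` on `[−2, 2] × E` (which contains the supports of all time cutoffs used).
[cite: Federer1969, 4.1.9] -/
def lipHomotopyMap (F G : E → E') (p : ℝ × E) : E' :=
  F p.2 + ((Set.projIcc (-2 : ℝ) 2 (by norm_num) p.1 : ℝ)) • (G p.2 - F p.2)

omit [NormedAddCommGroup E] [NormedSpace ℝ E] in
/-- On `[−2, 2] × E` the clamped homotopy is the affine homotopy. [folklore] -/
theorem lipHomotopyMap_eq_affineHomotopy [AddCommGroup E] [Module ℝ E] (F G : E → E') {p : ℝ × E} (hp : |p.1| ≤ 2) :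
    lipHomotopyMap F G p = affineHomotopy F G p := by
  unfold lipHomotopyMap affineHomotopy
  rw [Set.projIcc_of_mem _ (abs_le.1 hp)]

omit [NormedSpace ℝ E] in
/-- **The clamped homotopy is Lipschitz**: constant `3 L_F + 2 L_G + η` when `‖G − F‖ ≤ η`.
[cite: Federer1969, 4.1.9] -/
theorem lipschitzWith_lipHomotopyMap {F G : E → E'} {LF LG : ℝ≥0} (hF : LipschitzWith LF F)
    (hG : LipschitzWith LG G) {η : ℝ} (hη : 0 ≤ η) (hclose : ∀ x, ‖G x - F x‖ ≤ η) :
    LipschitzWith (3 * LF + 2 * LG + Real.toNNReal η) (lipHomotopyMap F G) := by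
  refine LipschitzWith.of_dist_le_mul fun p q => ?_
  set π : ℝ → ℝ := fun s => (Set.projIcc (-2 : ℝ) 2 (by norm_num) s : ℝ) with hπdef
  have hπ : ∀ s : ℝ, |π s| ≤ 2 := fun s =>
    abs_le.2 ⟨(Set.projIcc (-2 : ℝ) 2 (by norm_num) s).2.1, (Set.projIcc (-2 : ℝ) 2 (by norm_num) s).2.2⟩
  have hπlip : ∀ s s' : ℝ, |π s - π s'| ≤ |s - s'| := fun s s' => by
    have := (LipschitzWith.projIcc (a := (-2 : ℝ)) (b := 2) (by norm_num)).dist_le_mul s s'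
    rw [NNReal.coe_one, one_mul, Subtype.dist_eq, Real.dist_eq, Real.dist_eq] at this
    exact this
  have hd1 : dist p.1 q.1 ≤ dist p q := by rw [Prod.dist_eq]; exact le_max_left _ _
  have hd2 : dist p.2 q.2 ≤ dist p q := by rw [Prod.dist_eq]; exact le_max_right _ _
  have hFd := hF.dist_le_mul p.2 q.2
  have hGd := hG.dist_le_mul p.2 q.2
  have e : lipHomotopyMap F G p - lipHomotopyMap F G q =
      (F p.2 - F q.2) + (π p.1 - π q.1) • (G p.2 - F p.2) + π q.1 • ((G p.2 - G q.2) - (F p.2 - F q.2)) := by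
    unfold lipHomotopyMap
    simp only [hπdef, sub_smul, smul_sub]
    abel
  rw [dist_eq_norm, e]
  have hηc : ((Real.toNNReal η : ℝ≥0) : ℝ) = η := Real.coe_toNNReal _ hη
  calc ‖(F p.2 - F q.2) + (π p.1 - π q.1) • (G p.2 - F p.2) + π q.1 • ((G p.2 - G q.2) - (F p.2 - F q.2))‖
      ≤ ‖F p.2 - F q.2‖ + ‖(π p.1 - π q.1) • (G p.2 - F p.2)‖ + ‖π q.1 • ((G p.2 - G q.2) - (F p.2 - F q.2))‖ :=
        norm_add₃_le
    _ ≤ LF * dist p q + dist p q * η + 2 * (LG * dist p q + LF * dist p q) := by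
        refine add_le_add (add_le_add ?_ ?_) ?_
        · rw [← dist_eq_norm]; exact hFd.trans (mul_le_mul_of_nonneg_left hd2 LF.coe_nonneg)
        · rw [norm_smul, Real.norm_eq_abs]
          refine mul_le_mul ((hπlip _ _).trans ?_) (hclose _) (norm_nonneg _) dist_nonneg
          rw [← Real.dist_eq]; exact hd1
        · rw [norm_smul, Real.norm_eq_abs]
          refine mul_le_mul (hπ _) ((norm_sub_le _ _).trans (add_le_add ?_ ?_)) (norm_nonneg _) zero_le_two
          · rw [← dist_eq_norm]; exact hGd.trans (mul_le_mul_of_nonneg_left hd2 LG.coe_nonneg)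
          · rw [← dist_eq_norm]; exact hFd.trans (mul_le_mul_of_nonneg_left hd2 LF.coe_nonneg)
    _ = (3 * LF + 2 * LG + Real.toNNReal η : ℝ≥0) * dist p q := by
        push_cast
        rw [hηc]
        ring

end HomotopyMap

section LipHomotopy

variable {E E' : Type*} [NormedAddCommGroup E] [NormedSpace ℝ E] [FiniteDimensional ℝ E]
  [NormedAddCommGroup E'] [NormedSpace ℝ E'] [FiniteDimensional ℝ E']
  {Ω : Opens E} {Ω' : Opens E'} {m : ℕ}

namespace Current

variable (T : Current Ω (m + 1)) (hT : T.mass ≠ ⊤) (hdT : T.boundary.mass ≠ ⊤)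
  (hsupp : IsCompact T.support) {f : E → E'} {L : ℝ≥0} (hf : LipschitzWith L f)

include hT hdT in
/-- **`f_# T` is close to `g_# T` for smooth `g` near `f`, with ANY admissible cutoff**: if `χ = 1`
near `spt T`, `|χ| ≤ 1`, `‖Dg‖ ≤ L'` and `‖g − f‖ ≤ η` on `spt χ` (`L ≤ L'`), then
`|f_# T(φ) − g_# T(φ)| ≤ η [(5L')^{m+1} 𝐌(T) sup‖dφ‖ + (5L')^m 𝐌(∂T) sup‖φ‖]` (variant of
`abs_lipPushforward_sub_pushforward_le`). [cite: Federer1969, 4.1.14] -/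
theorem abs_lipPushforward_sub_pushforward_le' {χ : 𝓓(Ω, ℝ)} {U : Set E} (hU : IsOpen U)
    (hTU : T.support ⊆ U) (hχ1 : ∀ x ∈ U, χ x = 1) (hχabs : ∀ x, |χ x| ≤ 1)
    {g : E → E'} (hg : ContDiff ℝ ∞ g) {L' η : ℝ}
    (hLL' : (L : ℝ) ≤ L') (hD : ∀ x ∈ tsupport ⇑χ, ‖fderiv ℝ g x‖ ≤ L')
    (hη : 0 ≤ η) (hclose : ∀ x ∈ tsupport ⇑χ, ‖g x - f x‖ ≤ η)
    (φ : TestForm Ω' (m + 1)) {Cφ Cd : ℝ} (hCφ : 0 < Cφ) (hCd : 0 < Cd) (hφ : ∀ y, ‖φ y‖ ≤ Cφ)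
    (hdφ : ∀ y, ‖extDeriv ⇑φ y‖ ≤ Cd) :
    |T.lipPushforward hT hdT hsupp hf Ω' φ - T.pushforward Ω' χ hg φ| ≤
      η * ((5 * L') ^ (m + 1) * T.mass.toReal * Cd + (5 * L') ^ m * T.boundary.mass.toReal * Cφ) := by
  obtain ⟨hVo, h01, hρ1, hρabs, hρ2⟩ := timeCutoff_spec
  have hL' : 0 ≤ L' := L.coe_nonneg.trans hLL'
  set K := (5 * L') ^ (m + 1) * T.mass.toReal * Cd + (5 * L') ^ m * T.boundary.mass.toReal * Cφ
  have hn : ∀ n : ℕ, |T.lipPushSeq hsupp hf Ω' n φ - T.pushforward Ω' χ hg φ| ≤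
      (1 / ((n : ℝ) + 1) + η) * K := by
    intro n
    rw [T.lipPushSeq_eq_pushforward hsupp hf hU hTU hχ1 n]
    refine T.abs_pushforward_sub_apply_le hT hdT χ timeCutoff hU hTU hχ1 hχabs hVo
      h01 hρ1 hρabs hρ2 hg (contDiff_lipApprox hf n) hL' (by positivity) hD
      (fun x _ => (norm_fderiv_lipApprox_le hf n x).trans hLL') (fun x hx => ?_) φ hCφ hCd hφ hdφ
    calc ‖lipApprox hf n x - g x‖ ≤ ‖lipApprox hf n x - f x‖ + ‖f x - g x‖ :=
          norm_sub_le_norm_sub_add_norm_sub _ _ _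
      _ ≤ 1 / ((n : ℝ) + 1) + η := by
          refine add_le_add ?_ ?_
          · rw [← dist_eq_norm]; exact dist_lipApprox_le hf n x
          · rw [norm_sub_rev]; exact hclose x hx
  have hlim : Tendsto (fun n : ℕ => (1 / ((n : ℝ) + 1) + η) * K) atTop (𝓝 ((0 + η) * K)) :=
    ((tendsto_one_div_add_atTop_nhds_zero_nat.add tendsto_const_nhds).mul tendsto_const_nhds)
  rw [zero_add] at hlim
  exact le_of_tendsto_of_tendsto ((continuous_abs.tendsto _).comp
    ((T.tendsto_lipPushSeq hT hdT hsupp hf φ).sub tendsto_const_nhds)) hlim (Eventually.of_forall hn)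

include hT hdT in
/-- **Any admissible smooth approximation computes `f_# T`**: if `g_n` are smooth with
`‖Dg_n‖ ≤ L'` and `‖g_n − f‖ ≤ δ_n → 0` on `spt χ` (`χ` an admissible cutoff), then
`(g_n)_# T(φ) → f_# T(φ)`. [cite: Federer1969, 4.1.14] -/
theorem tendsto_pushforward_of_approx {χ : 𝓓(Ω, ℝ)} {U : Set E} (hU : IsOpen U)
    (hTU : T.support ⊆ U) (hχ1 : ∀ x ∈ U, χ x = 1) (hχabs : ∀ x, |χ x| ≤ 1)
    {g : ℕ → E → E'} (hg : ∀ n, ContDiff ℝ ∞ (g n)) {L' : ℝ} (hLL' : (L : ℝ) ≤ L')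
    (hD : ∀ n, ∀ x ∈ tsupport ⇑χ, ‖fderiv ℝ (g n) x‖ ≤ L') {δ : ℕ → ℝ} (hδ0 : ∀ n, 0 ≤ δ n)
    (hδ : Tendsto δ atTop (𝓝 0)) (hclose : ∀ n, ∀ x ∈ tsupport ⇑χ, ‖g n x - f x‖ ≤ δ n)
    (φ : TestForm Ω' (m + 1)) :
    Tendsto (fun n => T.pushforward Ω' χ (hg n) φ) atTop (𝓝 (T.lipPushforward hT hdT hsupp hf Ω' φ)) := by
  obtain ⟨Cφ, hCφ, hφ⟩ := φ.exists_norm_le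
  obtain ⟨Cd, hCd, hdφ⟩ := φ.exists_norm_extDeriv_le
  set K := (5 * L') ^ (m + 1) * T.mass.toReal * Cd + (5 * L') ^ m * T.boundary.mass.toReal * Cφ
  have hn : ∀ n, |T.pushforward Ω' χ (hg n) φ - T.lipPushforward hT hdT hsupp hf Ω' φ| ≤ δ n * K := by
    intro n
    rw [abs_sub_comm]
    exact T.abs_lipPushforward_sub_pushforward_le' hT hdT hsupp hf hU hTU hχ1 hχabs (hg n) hLL' (hD n)
      (hδ0 n) (hclose n) φ hCφ hCd hφ hdφ
  have hlim : Tendsto (fun n => δ n * K) atTop (𝓝 (0 * K)) := hδ.mul_const K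
  rw [zero_mul] at hlim
  rw [tendsto_iff_norm_sub_tendsto_zero]
  refine squeeze_zero_norm (fun n => ?_) hlim
  rw [norm_norm, Real.norm_eq_abs]
  exact hn n

end Current

/-! ### The homotopy current `H(F, G) T = Φ_# ([0,1] × T)` -/

namespace Current

variable (T : Current Ω (m + 1)) (hT : T.mass ≠ ⊤) (hdT : T.boundary.mass ≠ ⊤)
  (hsupp : IsCompact T.support) {F G : E → E'} {LF LG : ℝ≥0} (hF : LipschitzWith LF F)
  (hG : LipschitzWith LG G) {η : ℝ} (hη : 0 ≤ η) (hclose : ∀ x, ‖G x - F x‖ ≤ η)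

/-- **The homotopy current `H(F, G) T`** between the Lipschitz push-forwards `F_# T` and `G_# T`
[Federer1969, 4.1.9 / 4.1.14]: the Lipschitz push-forward of `[0, 1] × T` along the clamped affine
homotopy `Φ(t, x) = F x + π(t)(G x − F x)`. [cite: Federer1969, 4.1.9] -/
def lipHomotopy (Ω' : Opens E') : Current Ω' (m + 1 + 1) :=
  (T.prodInterval 0 1).lipPushforward (T.mass_prodInterval_ne_top hsupp hT)
    (T.mass_boundary_prodInterval_ne_top hsupp hT hdT) (T.isCompact_support_prodInterval hsupp 0 1)
    (lipschitzWith_lipHomotopyMap hF hG hη hclose) Ω'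

end Current

end LipHomotopy

/-! ## Homotopies along Lipschitz maps — Part D2: the homotopy formula and the mass bound -/

section LipHomotopyFormula

variable {E E' : Type*} [NormedAddCommGroup E] [NormedSpace ℝ E] [FiniteDimensional ℝ E]
  [NormedAddCommGroup E'] [NormedSpace ℝ E'] [FiniteDimensional ℝ E']
  {Ω : Opens E} {Ω' : Opens E'} {m : ℕ}

omit [FiniteDimensional ℝ E] in
/-- `‖fst‖ ≤ 1` on `ℝ × E`. [folklore] -/
theorem ContinuousLinearMap.norm_fst_le_one' : ‖ContinuousLinearMap.fst ℝ ℝ E‖ ≤ 1 :=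
  ContinuousLinearMap.opNorm_le_bound _ zero_le_one fun x => by
    rw [one_mul]; exact norm_fst_le x

omit [FiniteDimensional ℝ E] in
/-- `‖snd‖ ≤ 1` on `ℝ × E`. [folklore] -/
theorem ContinuousLinearMap.norm_snd_le_one' : ‖ContinuousLinearMap.snd ℝ ℝ E‖ ≤ 1 :=
  ContinuousLinearMap.opNorm_le_bound _ zero_le_one fun x => by
    rw [one_mul]; exact norm_snd_le x

omit [FiniteDimensional ℝ E] [FiniteDimensional ℝ E'] in
/-- **Derivative bound for the affine homotopy of two smooth Lipschitz maps** on `{|t| ≤ 2}`: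
`‖Dh(t, x)‖ ≤ ‖Df‖ + 2(‖Dg‖ + ‖Df‖) + ‖g x − f x‖`. [cite: Federer1969, 4.1.9] -/
theorem norm_fderiv_affineHomotopy_le {f g : E → E'} (hf : ContDiff ℝ ∞ f) (hg : ContDiff ℝ ∞ g)
    {L δ : ℝ} (hDf : ∀ x, ‖fderiv ℝ f x‖ ≤ L) (hDg : ∀ x, ‖fderiv ℝ g x‖ ≤ L)
    (hfg : ∀ x, ‖g x - f x‖ ≤ δ) {p : ℝ × E} (hp : |p.1| ≤ 2) :
    ‖fderiv ℝ (affineHomotopy f g) p‖ ≤ 5 * L + δ := by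
  rw [show p = ((p.1 : ℝ), p.2) from rfl, (hasFDerivAt_affineHomotopy hf hg p.1 p.2).fderiv]
  have hL : 0 ≤ L := (norm_nonneg _).trans (hDf p.2)
  calc ‖(fderiv ℝ f p.2).comp (ContinuousLinearMap.snd ℝ ℝ E) +
        (p.1 • ((fderiv ℝ g p.2 - fderiv ℝ f p.2).comp (ContinuousLinearMap.snd ℝ ℝ E)) +
          (ContinuousLinearMap.fst ℝ ℝ E).smulRight (g p.2 - f p.2))‖
      ≤ ‖(fderiv ℝ f p.2).comp (ContinuousLinearMap.snd ℝ ℝ E)‖ +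
        (‖p.1 • ((fderiv ℝ g p.2 - fderiv ℝ f p.2).comp (ContinuousLinearMap.snd ℝ ℝ E))‖ +
          ‖(ContinuousLinearMap.fst ℝ ℝ E).smulRight (g p.2 - f p.2)‖) :=
        (norm_add_le _ _).trans (add_le_add le_rfl (norm_add_le _ _))
    _ ≤ L * 1 + (2 * ((L + L) * 1) + 1 * δ) := by
        refine add_le_add ((ContinuousLinearMap.opNorm_comp_le _ _).trans
          (mul_le_mul (hDf _) ContinuousLinearMap.norm_snd_le_one' (norm_nonneg _) hL)) (add_le_add ?_ ?_)
        · rw [norm_smul, Real.norm_eq_abs]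
          refine mul_le_mul hp ((ContinuousLinearMap.opNorm_comp_le _ _).trans (mul_le_mul
            ((norm_sub_le _ _).trans (add_le_add (hDg _) (hDf _))) ContinuousLinearMap.norm_snd_le_one'
            (norm_nonneg _) (by positivity))) (norm_nonneg _) zero_le_two
        · rw [ContinuousLinearMap.norm_smulRight_apply]
          exact mul_le_mul ContinuousLinearMap.norm_fst_le_one' (hfg _) (norm_nonneg _) zero_le_one
    _ = 5 * L + δ := by ring

section Helpers

variable {F G : E → E'} {LF LG : ℝ≥0} (hF : LipschitzWith LF F) (hG : LipschitzWith LG G) {η : ℝ}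

include hF hG in
/-- `‖g_n − f_n‖ ≤ η + 2/(n+1)` for the approximants. [folklore] -/
theorem norm_lipApprox_sub_lipApprox_le (hclose : ∀ x, ‖G x - F x‖ ≤ η) (n : ℕ) (x : E) :
    ‖lipApprox hG n x - lipApprox hF n x‖ ≤ η + 2 / ((n : ℝ) + 1) := by
  calc ‖lipApprox hG n x - lipApprox hF n x‖
      ≤ ‖lipApprox hG n x - G x‖ + ‖G x - lipApprox hF n x‖ := norm_sub_le_norm_sub_add_norm_sub _ _ _
    _ ≤ ‖lipApprox hG n x - G x‖ + (‖G x - F x‖ + ‖F x - lipApprox hF n x‖) :=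
        add_le_add le_rfl (norm_sub_le_norm_sub_add_norm_sub _ _ _)
    _ ≤ 1 / ((n : ℝ) + 1) + (η + 1 / ((n : ℝ) + 1)) := by
        refine add_le_add ?_ (add_le_add (hclose x) ?_)
        · rw [← dist_eq_norm]; exact dist_lipApprox_le hG n x
        · rw [← dist_eq_norm, dist_comm]; exact dist_lipApprox_le hF n x
    _ = η + 2 / ((n : ℝ) + 1) := by ring

/-- The approximating homotopies are `5/(n+1)`-close to the clamped homotopy on `{|t| ≤ 2}`.
[folklore] -/
theorem norm_affineHomotopy_lipApprox_sub_le (n : ℕ) {p : ℝ × E} (hp : |p.1| ≤ 2) :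
    ‖affineHomotopy (lipApprox hF n) (lipApprox hG n) p - lipHomotopyMap F G p‖ ≤ 5 / ((n : ℝ) + 1) := by
  rw [lipHomotopyMap_eq_affineHomotopy F G hp]
  unfold affineHomotopy
  have e : lipApprox hF n p.2 + p.1 • (lipApprox hG n p.2 - lipApprox hF n p.2) - (F p.2 + p.1 • (G p.2 - F p.2)) =
      (lipApprox hF n p.2 - F p.2) + p.1 • ((lipApprox hG n p.2 - G p.2) - (lipApprox hF n p.2 - F p.2)) := by
    simp only [smul_sub]; abel
  rw [e]
  calc ‖(lipApprox hF n p.2 - F p.2) + p.1 • ((lipApprox hG n p.2 - G p.2) - (lipApprox hF n p.2 - F p.2))‖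
      ≤ ‖lipApprox hF n p.2 - F p.2‖ + |p.1| * (‖lipApprox hG n p.2 - G p.2‖ + ‖lipApprox hF n p.2 - F p.2‖) := by
        refine (norm_add_le _ _).trans (add_le_add le_rfl ?_)
        rw [norm_smul, Real.norm_eq_abs]
        exact mul_le_mul_of_nonneg_left (norm_sub_le _ _) (abs_nonneg _)
    _ ≤ 1 / ((n : ℝ) + 1) + 2 * (1 / ((n : ℝ) + 1) + 1 / ((n : ℝ) + 1)) := by
        have h1 : ‖lipApprox hF n p.2 - F p.2‖ ≤ 1 / ((n : ℝ) + 1) := by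
          rw [← dist_eq_norm]; exact dist_lipApprox_le hF n _
        have h2 : ‖lipApprox hG n p.2 - G p.2‖ ≤ 1 / ((n : ℝ) + 1) := by
          rw [← dist_eq_norm]; exact dist_lipApprox_le hG n _
        exact add_le_add h1 (mul_le_mul hp (add_le_add h2 h1) (by positivity) zero_le_two)
    _ = 5 / ((n : ℝ) + 1) := by ring

/-- Derivative bound for the approximating homotopies on `{|t| ≤ 2}`: `≤ 5 max(L_F, L_G) + η + 2`.
[folklore] -/
theorem norm_fderiv_affineHomotopy_lipApprox_le (hclose : ∀ x, ‖G x - F x‖ ≤ η) (n : ℕ)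
    {p : ℝ × E} (hp : |p.1| ≤ 2) :
    ‖fderiv ℝ (affineHomotopy (lipApprox hF n) (lipApprox hG n)) p‖ ≤ 5 * max (LF : ℝ) LG + (η + 2) := by
  refine norm_fderiv_affineHomotopy_le (contDiff_lipApprox hF n) (contDiff_lipApprox hG n)
    (fun x => (norm_fderiv_lipApprox_le hF n x).trans (le_max_left _ _))
    (fun x => (norm_fderiv_lipApprox_le hG n x).trans (le_max_right _ _)) (fun x => ?_) hp
  refine (norm_lipApprox_sub_lipApprox_le hF hG hclose n x).trans (add_le_add le_rfl ?_)
  rw [div_le_iff₀ (by positivity)]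
  linarith [n.cast_nonneg (α := ℝ)]

/-- The Lipschitz constant of the clamped homotopy is `≤ 5 max(L_F, L_G) + η + 2`. [folklore] -/
theorem coe_lipHomotopy_const_le (LF LG : ℝ≥0) (hη : 0 ≤ η) :
    ((3 * LF + 2 * LG + Real.toNNReal η : ℝ≥0) : ℝ) ≤ 5 * max (LF : ℝ) LG + (η + 2) := by
  push_cast
  rw [Real.coe_toNNReal _ hη]
  have h1 : (LF : ℝ) ≤ max (LF : ℝ) LG := le_max_left _ _
  have h2 : (LG : ℝ) ≤ max (LF : ℝ) LG := le_max_right _ _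
  linarith [LF.coe_nonneg, LG.coe_nonneg]

/-- `c/(n+1) → 0`. [folklore] -/
theorem tendsto_const_div_add_one (c : ℝ) : Tendsto (fun n : ℕ => c / ((n : ℝ) + 1)) atTop (𝓝 0) := by
  have h := tendsto_one_div_add_atTop_nhds_zero_nat.const_mul c
  rw [mul_zero] at h
  exact h.congr fun n => by ring

end Helpers

namespace Current

variable (T : Current Ω (m + 1)) (hT : T.mass ≠ ⊤) (hdT : T.boundary.mass ≠ ⊤)
  (hsupp : IsCompact T.support) {F G : E → E'} {LF LG : ℝ≥0} (hF : LipschitzWith LF F)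
  (hG : LipschitzWith LG G) {η : ℝ} (hη : 0 ≤ η) (hclose : ∀ x, ‖G x - F x‖ ≤ η)

/-- The smooth affine homotopy push-forwards `hₙ_# ([0,1] × T)` along the approximants
`(lipApprox F n, lipApprox G n)`, with the tensor cutoff `ρ ⊗ χ_T`. [cite: Federer1969, 4.1.9] -/
def lipHomotopySeq (Ω' : Opens E') (n : ℕ) : Current Ω' (m + 1 + 1) :=
  (T.prodInterval 0 1).pushforward Ω' (TestFunction.tensorCutoff timeCutoff (T.cutoff hsupp))
    (contDiff_affineHomotopy (contDiff_lipApprox hF n) (contDiff_lipApprox hG n))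

include hη hclose in
/-- **The smooth homotopies converge to `H(F, G) S`** for every normal `S` with compact support whose
support lies in that of `T` (applied to `S = T` and `S = ∂T`; the cutoff is `ρ ⊗ χ_T`).
[cite: Federer1969, 4.1.9, 4.1.14] -/
theorem tendsto_lipHomotopySeq' {k : ℕ} (S : Current Ω (k + 1)) (hS : S.mass ≠ ⊤) (hdS : S.boundary.mass ≠ ⊤)
    (hSsupp : IsCompact S.support) (hST : S.support ⊆ T.support) (ψ : TestForm Ω' (k + 1 + 1)) :
    Tendsto (fun n => (S.prodInterval 0 1).pushforward Ω' (TestFunction.tensorCutoff timeCutoff (T.cutoff hsupp))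
        (contDiff_affineHomotopy (contDiff_lipApprox hF n) (contDiff_lipApprox hG n)) ψ) atTop
      (𝓝 (S.lipHomotopy hS hdS hSsupp hF hG hη hclose Ω' ψ)) := by
  obtain ⟨hUo, hTU, hχ1, hχabs⟩ := T.cutoff_spec hsupp
  obtain ⟨hVo, h01, hρ1, hρabs, hρ2⟩ := timeCutoff_spec
  unfold Current.lipHomotopy
  refine (S.prodInterval 0 1).tendsto_pushforward_of_approx (S.mass_prodInterval_ne_top hSsupp hS)
    (S.mass_boundary_prodInterval_ne_top hSsupp hS hdS) (S.isCompact_support_prodInterval hSsupp 0 1)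
    (lipschitzWith_lipHomotopyMap hF hG hη hclose) (hVo.prod hUo)
    ((S.support_prodInterval_subset 0 1).trans (Set.prod_mono
      (by rw [Set.uIcc_of_le zero_le_one]; exact h01) (hST.trans hTU)))
    (fun p hp => by rw [TestFunction.tensorCutoff_apply, hρ1 _ hp.1, hχ1 _ hp.2, one_mul])
    (fun p => by
      rw [TestFunction.tensorCutoff_apply, abs_mul]
      exact mul_le_one₀ (hρabs _) (abs_nonneg _) (hχabs _))
    (fun n => contDiff_affineHomotopy (contDiff_lipApprox hF n) (contDiff_lipApprox hG n))
    (coe_lipHomotopy_const_le LF LG hη)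
    (fun n p hp => norm_fderiv_affineHomotopy_lipApprox_le hF hG hclose n
      (hρ2 _ (TestFunction.tsupport_tensorCutoff_subset _ _ hp).1))
    (δ := fun n => 5 / ((n : ℝ) + 1)) (fun n => by positivity) (tendsto_const_div_add_one 5)
    (fun n p hp => norm_affineHomotopy_lipApprox_sub_le hF hG n
      (hρ2 _ (TestFunction.tsupport_tensorCutoff_subset _ _ hp).1)) ψ

include hη hclose in
/-- `hₙ_# ([0,1] × T)(ψ) → H(F,G) T(ψ)`. [cite: Federer1969, 4.1.9] -/
theorem tendsto_lipHomotopySeq (ψ : TestForm Ω' (m + 1 + 1)) :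
    Tendsto (fun n => T.lipHomotopySeq hsupp hF hG Ω' n ψ) atTop
      (𝓝 (T.lipHomotopy hT hdT hsupp hF hG hη hclose Ω' ψ)) :=
  T.tendsto_lipHomotopySeq' hsupp hF hG hη hclose T hT hdT hsupp le_rfl ψ

include hη hclose in
/-- **The homotopy formula for Lipschitz maps** [Federer1969, 4.1.9, 4.1.14]:
`G_# T − F_# T = ∂ H(F,G) T + H(F,G) ∂T` for a normal current `T` of degree `≥ 2` with compact
support (limit of the smooth affine homotopy formula along the approximants). [cite: Federer1969, 4.1.9] -/
theorem lipPushforward_sub_lipPushforward_eq (T : Current Ω (m + 1 + 1)) (hT : T.mass ≠ ⊤)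
    (hdT : T.boundary.mass ≠ ⊤) (hsupp : IsCompact T.support) :
    T.lipPushforward hT hdT hsupp hG Ω' - T.lipPushforward hT hdT hsupp hF Ω' =
      (T.lipHomotopy hT hdT hsupp hF hG hη hclose Ω').boundary +
        T.boundary.lipHomotopy hdT T.boundary_boundary_mass_ne_top (T.isCompact_support_boundary hsupp)
          hF hG hη hclose Ω' := by
  ext φ
  obtain ⟨hUo, hTU, hχ1, hχabs⟩ := T.cutoff_spec hsupp
  obtain ⟨hVo, h01, hρ1, hρabs, hρ2⟩ := timeCutoff_spec
  have hform : ∀ n : ℕ, T.lipPushSeq hsupp hG Ω' n φ - T.lipPushSeq hsupp hF Ω' n φ =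
      T.lipHomotopySeq hsupp hF hG Ω' n (TestForm.extDerivCLM φ) +
        (T.boundary.prodInterval 0 1).pushforward Ω' (TestFunction.tensorCutoff timeCutoff (T.cutoff hsupp))
          (contDiff_affineHomotopy (contDiff_lipApprox hF n) (contDiff_lipApprox hG n)) φ := by
    intro n
    have h := T.homotopy_formula_affine (Ω' := Ω') (T.cutoff hsupp) timeCutoff (contDiff_lipApprox hF n)
      (contDiff_lipApprox hG n) hUo hTU hχ1 hVo h01 hρ1
    have h' := DFunLike.congr_fun h φ
    simpa [Current.lipPushSeq, Current.lipHomotopySeq, Current.boundary_apply] using h'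
  have hl := (T.tendsto_lipPushSeq hT hdT hsupp hG φ).sub (T.tendsto_lipPushSeq hT hdT hsupp hF φ)
  have hr := (T.tendsto_lipHomotopySeq hT hdT hsupp hF hG hη hclose (TestForm.extDerivCLM φ)).add
    (T.tendsto_lipHomotopySeq' hsupp hF hG hη hclose T.boundary hdT T.boundary_boundary_mass_ne_top
      (T.isCompact_support_boundary hsupp) T.support_boundary_subset φ)
  have := tendsto_nhds_unique hl (hr.congr fun n => (hform n).symm)
  rw [show (T.lipPushforward hT hdT hsupp hG Ω' - T.lipPushforward hT hdT hsupp hF Ω') φ =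
      T.lipPushforward hT hdT hsupp hG Ω' φ - T.lipPushforward hT hdT hsupp hF Ω' φ from rfl, this]
  rfl

include hη hclose in
/-- **Mass of the Lipschitz homotopy current** [Federer1969, 4.1.9]:
`𝐌(H(F,G) T) ≤ η (5 max(Lip F, Lip G))^{m+1} 𝐌(T)` when `‖G − F‖ ≤ η`. [cite: Federer1969, 4.1.9] -/
theorem mass_lipHomotopy_le :
    (T.lipHomotopy hT hdT hsupp hF hG hη hclose Ω').mass ≤
      ENNReal.ofReal (η * (5 * max (LF : ℝ) LG) ^ (m + 1)) * T.mass := by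
  obtain ⟨hUo, hTU, hχ1, hχabs⟩ := T.cutoff_spec hsupp
  obtain ⟨hVo, h01, hρ1, hρabs, hρ2⟩ := timeCutoff_spec
  set L : ℝ := max (LF : ℝ) LG
  have hL : 0 ≤ L := le_max_of_le_left LF.coe_nonneg
  have hmass : ∀ n : ℕ, (T.lipHomotopySeq hsupp hF hG Ω' n).mass ≤
      ENNReal.ofReal ((η + 2 / ((n : ℝ) + 1)) * (5 * L) ^ (m + 1)) * T.mass := by
    intro n
    refine T.mass_affineHomotopy_le _ _ (contDiff_lipApprox hF n) (contDiff_lipApprox hG n)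
      (by positivity) hρabs fun t ht x _ => ?_
    have h1 : ‖fderiv ℝ (lipApprox hF n) x + t • (fderiv ℝ (lipApprox hG n) x - fderiv ℝ (lipApprox hF n) x)‖
        ≤ 5 * L := by
      calc _ ≤ ‖fderiv ℝ (lipApprox hF n) x‖ + ‖t • (fderiv ℝ (lipApprox hG n) x - fderiv ℝ (lipApprox hF n) x)‖ :=
            norm_add_le _ _
        _ ≤ L + |t| * (L + L) := by
            rw [norm_smul, Real.norm_eq_abs]
            refine add_le_add ((norm_fderiv_lipApprox_le hF n x).trans (le_max_left _ _))
              (mul_le_mul_of_nonneg_left ?_ (abs_nonneg _))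
            exact (norm_sub_le _ _).trans (add_le_add
              ((norm_fderiv_lipApprox_le hG n x).trans (le_max_right _ _))
              ((norm_fderiv_lipApprox_le hF n x).trans (le_max_left _ _)))
        _ ≤ L + 2 * (L + L) := by have := hρ2 t ht; nlinarith
        _ = 5 * L := by ring
    calc |T.cutoff hsupp x| * ‖lipApprox hG n x - lipApprox hF n x‖ *
          ‖fderiv ℝ (lipApprox hF n) x + t • (fderiv ℝ (lipApprox hG n) x - fderiv ℝ (lipApprox hF n) x)‖ ^ (m + 1)
        ≤ 1 * (η + 2 / ((n : ℝ) + 1)) * (5 * L) ^ (m + 1) := by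
          refine mul_le_mul (mul_le_mul (hχabs x) (norm_lipApprox_sub_lipApprox_le hF hG hclose n x)
            (norm_nonneg _) zero_le_one) (pow_le_pow_left₀ (norm_nonneg _) h1 _) (by positivity)
            (by positivity)
      _ = (η + 2 / ((n : ℝ) + 1)) * (5 * L) ^ (m + 1) := by ring
  have hlim : Tendsto (fun n : ℕ => ENNReal.ofReal ((η + 2 / ((n : ℝ) + 1)) * (5 * L) ^ (m + 1)) * T.mass)
      atTop (𝓝 (ENNReal.ofReal (η * (5 * L) ^ (m + 1)) * T.mass)) := by
    refine ENNReal.Tendsto.mul_const (ENNReal.tendsto_ofReal ?_) (Or.inr hT)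
    have h2 : Tendsto (fun n : ℕ => 2 / ((n : ℝ) + 1)) atTop (𝓝 0) := tendsto_const_div_add_one 2
    have := ((tendsto_const_nhds (x := η)).add h2).mul_const ((5 * L) ^ (m + 1))
    rwa [add_zero] at this
  refine (Current.mass_le_liminf (T.tendsto_lipHomotopySeq hT hdT hsupp hF hG hη hclose)).trans ?_
  rw [← hlim.liminf_eq]
  exact liminf_le_liminf (Eventually.of_forall hmass)

end Current

end LipHomotopyFormula

/-! ## The admissible homotopy `H_v(g₁, g₂) S` (Federer 4.2.2) — Part D3 -/

section PairExtension

open Cubical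

variable {V : Type*} [NormedAddCommGroup V] [InnerProductSpace ℝ V] {n : ℕ}

/-- **Bounded Lipschitz extension through coordinates**: a `K`-Lipschitz map on a subset, bounded
by `M` there, extends to a `√n K`-Lipschitz map bounded by `√n M` (clamp each coordinate to
`[−M, M]`). [folklore] -/
theorem LipschitzOnWith.exists_extension_inner_norm_le (b : OrthonormalBasis (Fin n) ℝ V) {α : Type*}
    [PseudoMetricSpace α] {g : α → V} {A : Set α} {K : ℝ≥0} (hg : LipschitzOnWith K g A) {M : ℝ}
    (hM : 0 ≤ M) (hgM : ∀ x ∈ A, ‖g x‖ ≤ M) :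
    ∃ G : α → V, LipschitzWith (NNReal.sqrt n * K) G ∧ Set.EqOn G g A ∧ ∀ x, ‖G x‖ ≤ Real.sqrt n * M := by
  have h1 : LipschitzOnWith K (fun x => coord b (g x)) A :=
    LipschitzOnWith.of_dist_le_mul fun x hx y hy =>
      (dist_coord_le b _ _).trans (hg.dist_le_mul x hx y hy)
  obtain ⟨G₀, hG₀, heq⟩ := h1.extend_pi
  -- clamp the coordinates
  set G₁ : α → Fin n → ℝ := fun x i => max (min (G₀ x i) M) (-M) with hG₁
  have hclamp : ∀ a c : ℝ, |max (min a M) (-M) - max (min c M) (-M)| ≤ |a - c| := fun a c =>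
    (abs_max_sub_max_le_abs _ _ _).trans (by
      have := abs_min_sub_min_le_max a M c M
      rwa [sub_self, abs_zero, max_eq_left (abs_nonneg _)] at this)
  have hG₁lip : LipschitzWith K G₁ := by
    refine LipschitzWith.of_dist_le_mul fun x y => ?_
    refine (dist_pi_le_iff (by positivity)).2 fun i => ?_
    rw [Real.dist_eq]
    exact (hclamp _ _).trans (by rw [← Real.dist_eq]; exact (dist_le_pi_dist _ _ i).trans (hG₀.dist_le_mul x y))
  have hG₁bd : ∀ x, ‖G₁ x‖ ≤ M := fun x =>
    (pi_norm_le_iff_of_nonneg hM).2 fun i => by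
      rw [Real.norm_eq_abs, abs_le]
      exact ⟨le_max_right _ _, max_le ((min_le_right _ _)) (by linarith)⟩
  refine ⟨fun x => uncoord b (G₁ x), LipschitzWith.of_dist_le_mul fun x y => ?_, fun x hx => ?_, fun x => ?_⟩
  · calc dist (uncoord b (G₁ x)) (uncoord b (G₁ y)) ≤ Real.sqrt n * dist (G₁ x) (G₁ y) :=
          dist_uncoord_le b _ _
      _ ≤ Real.sqrt n * (K * dist x y) :=
          mul_le_mul_of_nonneg_left (hG₁lip.dist_le_mul x y) (Real.sqrt_nonneg _)
      _ = (NNReal.sqrt n * K : ℝ≥0) * dist x y := by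
          rw [NNReal.coe_mul, Real.coe_sqrt]; push_cast; ring
  · show uncoord b (G₁ x) = g x
    have hG₀x : G₀ x = coord b (g x) := (heq hx).symm
    have hG₁x : G₁ x = coord b (g x) := by
      funext i
      simp only [hG₁, hG₀x]
      have hi : |coord b (g x) i| ≤ M :=
        ((norm_le_pi_norm (coord b (g x)) i).trans ((norm_coord_le b _).trans (hgM x hx)))
      rw [min_eq_left (abs_le.1 hi).2, max_eq_left (abs_le.1 hi).1]
    rw [hG₁x]
    exact uncoord_coord b (g x)
  · calc ‖uncoord b (G₁ x)‖ = dist (uncoord b (G₁ x)) (uncoord b 0) := by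
          rw [dist_eq_norm]; simp [uncoord]
      _ ≤ Real.sqrt n * dist (G₁ x) 0 := dist_uncoord_le b _ _
      _ = Real.sqrt n * ‖G₁ x‖ := by rw [dist_zero_right]
      _ ≤ Real.sqrt n * M := mul_le_mul_of_nonneg_left (hG₁bd x) (Real.sqrt_nonneg _)

variable {v : V → ℝ} {g₁ g₂ : V → V} {C : ℝ}

/-- **Pair extensions**: beside `G¹_r = ext g₁`, an extension `G²_r` of `g₂ | {v ≥ r/2}` with
`Lip ≤ 3 · extConst r` and **`‖G²_r − G¹_r‖ ≤ √n η₀` everywhere**, when `‖g₂ − g₁‖ ≤ η₀` on `{v > 0}`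
(`G² = G¹ +` a bounded extension of `g₂ − g₁`). [cite: Federer1969, 4.2.2] -/
theorem Admissible.exists_ext_pair (b : OrthonormalBasis (Fin n) ℝ V) (h₁ : Admissible v g₁ C)
    (h₂ : Admissible v g₂ C) (hC : 0 ≤ C) {η₀ : ℝ} (hη₀ : 0 ≤ η₀)
    (hclose : ∀ x, 0 < v x → ‖g₂ x - g₁ x‖ ≤ η₀) {r : ℝ} (hr : 0 < r) :
    ∃ G₂ : V → V, LipschitzWith (3 * extConst n C r) G₂ ∧ Set.EqOn G₂ g₂ {x | r / 2 ≤ v x} ∧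
      ∀ x, ‖G₂ x - h₁.ext b hC hr x‖ ≤ Real.sqrt n * η₀ := by
  have hd : LipschitzOnWith (Real.toNNReal (C / (r / 2)) + Real.toNNReal (C / (r / 2)))
      (fun x => g₂ x - g₁ x) {x | r / 2 ≤ v x} :=
    (h₂.lipschitzOnWith hC (half_pos hr)).sub (h₁.lipschitzOnWith hC (half_pos hr))
  obtain ⟨D, hDlip, hDeq, hDbd⟩ := LipschitzOnWith.exists_extension_inner_norm_le b hd hη₀ fun x hx =>
    hclose x (lt_of_lt_of_le (half_pos hr) hx)
  refine ⟨fun x => h₁.ext b hC hr x + D x, ?_, fun x hx => ?_, fun x => ?_⟩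
  · have := (h₁.lipschitzWith_ext b hC hr).add hDlip
    refine this.weaken (le_of_eq ?_)
    unfold extConst; ring
  · show h₁.ext b hC hr x + D x = g₂ x
    rw [h₁.ext_eqOn b hC hr hx, hDeq hx, add_sub_cancel]
  · rw [add_sub_cancel_left]; exact hDbd x

/-- A chosen second extension `G²_r`. [cite: Federer1969, 4.2.2] -/
def Admissible.ext₂ (b : OrthonormalBasis (Fin n) ℝ V) (h₁ : Admissible v g₁ C) (h₂ : Admissible v g₂ C)
    (hC : 0 ≤ C) {η₀ : ℝ} (hη₀ : 0 ≤ η₀) (hclose : ∀ x, 0 < v x → ‖g₂ x - g₁ x‖ ≤ η₀) {r : ℝ}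
    (hr : 0 < r) : V → V :=
  Classical.choose (h₁.exists_ext_pair b h₂ hC hη₀ hclose hr)

/-- `G²_r` is Lipschitz. [cite: Federer1969, 4.2.2] -/
theorem Admissible.lipschitzWith_ext₂ (b : OrthonormalBasis (Fin n) ℝ V) (h₁ : Admissible v g₁ C)
    (h₂ : Admissible v g₂ C) (hC : 0 ≤ C) {η₀ : ℝ} (hη₀ : 0 ≤ η₀)
    (hclose : ∀ x, 0 < v x → ‖g₂ x - g₁ x‖ ≤ η₀) {r : ℝ} (hr : 0 < r) :
    LipschitzWith (3 * extConst n C r) (h₁.ext₂ b h₂ hC hη₀ hclose hr) :=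
  (Classical.choose_spec (h₁.exists_ext_pair b h₂ hC hη₀ hclose hr)).1

/-- `G²_r = g₂` on `{v ≥ r/2}`. [cite: Federer1969, 4.2.2] -/
theorem Admissible.ext₂_eqOn (b : OrthonormalBasis (Fin n) ℝ V) (h₁ : Admissible v g₁ C)
    (h₂ : Admissible v g₂ C) (hC : 0 ≤ C) {η₀ : ℝ} (hη₀ : 0 ≤ η₀)
    (hclose : ∀ x, 0 < v x → ‖g₂ x - g₁ x‖ ≤ η₀) {r : ℝ} (hr : 0 < r) :
    Set.EqOn (h₁.ext₂ b h₂ hC hη₀ hclose hr) g₂ {x | r / 2 ≤ v x} :=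
  (Classical.choose_spec (h₁.exists_ext_pair b h₂ hC hη₀ hclose hr)).2.1

/-- `‖G²_r − G¹_r‖ ≤ √n η₀`. [cite: Federer1969, 4.2.2] -/
theorem Admissible.norm_ext₂_sub_ext_le (b : OrthonormalBasis (Fin n) ℝ V) (h₁ : Admissible v g₁ C)
    (h₂ : Admissible v g₂ C) (hC : 0 ≤ C) {η₀ : ℝ} (hη₀ : 0 ≤ η₀)
    (hclose : ∀ x, 0 < v x → ‖g₂ x - g₁ x‖ ≤ η₀) {r : ℝ} (hr : 0 < r) (x : V) :
    ‖h₁.ext₂ b h₂ hC hη₀ hclose hr x - h₁.ext b hC hr x‖ ≤ Real.sqrt n * η₀ :=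
  (Classical.choose_spec (h₁.exists_ext_pair b h₂ hC hη₀ hclose hr)).2.2 x

/-- Two second extensions agree on `{v > r/2}` (`r' ≤ r`). [folklore] -/
theorem Admissible.ext₂_eqOn_ext₂ (b : OrthonormalBasis (Fin n) ℝ V) (h₁ : Admissible v g₁ C)
    (h₂ : Admissible v g₂ C) (hC : 0 ≤ C) {η₀ : ℝ} (hη₀ : 0 ≤ η₀)
    (hclose : ∀ x, 0 < v x → ‖g₂ x - g₁ x‖ ≤ η₀) {r r' : ℝ} (hr : 0 < r) (hr' : 0 < r') (hle : r' ≤ r) :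
    Set.EqOn (h₁.ext₂ b h₂ hC hη₀ hclose hr) (h₁.ext₂ b h₂ hC hη₀ hclose hr') {x | r / 2 < v x} :=
  fun x hx => by
    have hx' : r / 2 < v x := hx
    exact (h₁.ext₂_eqOn b h₂ hC hη₀ hclose hr hx'.le).trans
      (h₁.ext₂_eqOn b h₂ hC hη₀ hclose hr' (show r' / 2 ≤ v x by linarith)).symm

end PairExtension

section LipHomotopyAlgebra

variable {E E' : Type*} [NormedAddCommGroup E] [NormedSpace ℝ E] [FiniteDimensional ℝ E]
  [NormedAddCommGroup E'] [NormedSpace ℝ E'] [FiniteDimensional ℝ E']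
  {Ω : Opens E} {Ω' : Opens E'} {m : ℕ}

namespace Current

/-- **`H(F, G) T` depends only on `F, G` near `spt T`.** [cite: Federer1969, 4.1.9] -/
theorem lipHomotopy_congr (T : Current Ω (m + 1)) (hT : T.mass ≠ ⊤) (hdT : T.boundary.mass ≠ ⊤)
    (hsupp : IsCompact T.support) {F G F' G' : E → E'} {LF LG LF' LG' : ℝ≥0}
    (hF : LipschitzWith LF F) (hG : LipschitzWith LG G) (hF' : LipschitzWith LF' F') (hG' : LipschitzWith LG' G')
    {η η' : ℝ} (hη : 0 ≤ η) (hclose : ∀ x, ‖G x - F x‖ ≤ η) (hη' : 0 ≤ η') (hclose' : ∀ x, ‖G' x - F' x‖ ≤ η')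
    {N : Set E} (hN : IsOpen N) (hTN : T.support ⊆ N) (hFN : Set.EqOn F F' N) (hGN : Set.EqOn G G' N) :
    T.lipHomotopy hT hdT hsupp hF hG hη hclose Ω' = T.lipHomotopy hT hdT hsupp hF' hG' hη' hclose' Ω' := by
  unfold Current.lipHomotopy
  refine (T.prodInterval 0 1).lipPushforward_congr _ _ _ _ _ (isOpen_univ.prod hN)
    ((T.support_prodInterval_subset 0 1).trans (Set.prod_mono (Set.subset_univ _) hTN)) fun p hp => ?_
  unfold lipHomotopyMap
  rw [hFN hp.2, hGN hp.2]

/-- **Additivity of `H(F, G)` in the current.** [cite: Federer1969, 4.1.9] -/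
theorem lipHomotopy_add {T₁ T₂ : Current Ω (m + 1)}
    (h₁ : T₁.mass ≠ ⊤) (hd₁ : T₁.boundary.mass ≠ ⊤) (hs₁ : IsCompact T₁.support)
    (h₂ : T₂.mass ≠ ⊤) (hd₂ : T₂.boundary.mass ≠ ⊤) (hs₂ : IsCompact T₂.support)
    (h₁₂ : (T₁ + T₂).mass ≠ ⊤) (hd₁₂ : (T₁ + T₂).boundary.mass ≠ ⊤) (hs₁₂ : IsCompact (T₁ + T₂).support)
    {F G : E → E'} {LF LG : ℝ≥0} (hF : LipschitzWith LF F) (hG : LipschitzWith LG G)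
    {η : ℝ} (hη : 0 ≤ η) (hclose : ∀ x, ‖G x - F x‖ ≤ η) :
    (T₁ + T₂).lipHomotopy h₁₂ hd₁₂ hs₁₂ hF hG hη hclose Ω' =
      T₁.lipHomotopy h₁ hd₁ hs₁ hF hG hη hclose Ω' + T₂.lipHomotopy h₂ hd₂ hs₂ hF hG hη hclose Ω' := by
  unfold Current.lipHomotopy
  have key := Current.lipPushforward_add' (Ω' := Ω') (T₁ := T₁.prodInterval 0 1) (T₂ := T₂.prodInterval 0 1)
    (T₁.mass_prodInterval_ne_top hs₁ h₁) (T₁.mass_boundary_prodInterval_ne_top hs₁ h₁ hd₁)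
    (T₁.isCompact_support_prodInterval hs₁ 0 1)
    (T₂.mass_prodInterval_ne_top hs₂ h₂) (T₂.mass_boundary_prodInterval_ne_top hs₂ h₂ hd₂)
    (T₂.isCompact_support_prodInterval hs₂ 0 1)
    (by rw [← Current.prodInterval_add]; exact (T₁ + T₂).mass_prodInterval_ne_top hs₁₂ h₁₂)
    (by rw [← Current.prodInterval_add]; exact (T₁ + T₂).mass_boundary_prodInterval_ne_top hs₁₂ h₁₂ hd₁₂)
    (by rw [← Current.prodInterval_add]; exact (T₁ + T₂).isCompact_support_prodInterval hs₁₂ 0 1)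
    (lipschitzWith_lipHomotopyMap hF hG hη hclose)
  rw [← key]
  congr 1
  exact Current.prodInterval_add T₁ T₂ 0 1

end Current

end LipHomotopyAlgebra

section AdmissibleHomotopy

open Cubical

variable {V : Type*} [NormedAddCommGroup V] [InnerProductSpace ℝ V] [FiniteDimensional ℝ V]
  [MeasurableSpace V] [BorelSpace V] {n d : ℕ} {v : V → ℝ} {g₁ g₂ : V → V} {C : ℝ}
  {S : Current (⊤ : Opens V) (d + 1)}

variable (b : OrthonormalBasis (Fin n) ℝ V) (hS : S.mass ≠ ⊤) (hsupp : IsCompact S.support)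
  (hv : Continuous v) (h₁ : Admissible v g₁ C) (h₂ : Admissible v g₂ C) (hC : 0 ≤ C)
  {η₀ : ℝ} (hη₀ : 0 ≤ η₀) (hclose : ∀ x, 0 < v x → ‖g₂ x - g₁ x‖ ≤ η₀)

/-- Nonnegativity of the global closeness bound `√n η₀`. [folklore] -/
theorem sqrt_mul_nonneg (n : ℕ) {η₀ : ℝ} (hη₀ : 0 ≤ η₀) : 0 ≤ Real.sqrt n * η₀ :=
  mul_nonneg (Real.sqrt_nonneg _) hη₀

/-- **`H_r = H(G¹_r, G²_r)(S ⌞ {v > r})`** for a good radius. [cite: Federer1969, 4.2.2] -/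
def Current.admHom (b : OrthonormalBasis (Fin n) ℝ V) (S : Current (⊤ : Opens V) (d + 1))
    (hS : S.mass ≠ ⊤) (hsupp : IsCompact S.support) (hv : Continuous v) (h₁ : Admissible v g₁ C)
    (h₂ : Admissible v g₂ C) (hC : 0 ≤ C) {η₀ : ℝ} (hη₀ : 0 ≤ η₀)
    (hclose : ∀ x, 0 < v x → ‖g₂ x - g₁ x‖ ≤ η₀) {r : ℝ} (hr : 0 < r)
    (hgood : (S.restrictAbove hS hv r).boundary.mass ≠ ⊤) : Current (⊤ : Opens V) (d + 1 + 1) :=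
  (S.restrictAbove hS hv r).lipHomotopy (S.mass_restrictAbove_ne_top hS hv r) hgood
    (S.isCompact_support_restrictAbove hS hsupp hv r) (h₁.lipschitzWith_ext b hC hr)
    (h₁.lipschitzWith_ext₂ b h₂ hC hη₀ hclose hr) (sqrt_mul_nonneg n hη₀)
    (h₁.norm_ext₂_sub_ext_le b h₂ hC hη₀ hclose hr) ⊤

/-- The homotopy of a shell by the `r'`-pair. [cite: Federer1969, 4.2.2] -/
def Current.admHomShell (b : OrthonormalBasis (Fin n) ℝ V) (S : Current (⊤ : Opens V) (d + 1))
    (hS : S.mass ≠ ⊤) (hsupp : IsCompact S.support) (hv : Continuous v) (h₁ : Admissible v g₁ C)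
    (h₂ : Admissible v g₂ C) (hC : 0 ≤ C) {η₀ : ℝ} (hη₀ : 0 ≤ η₀)
    (hclose : ∀ x, 0 < v x → ‖g₂ x - g₁ x‖ ≤ η₀) {r' : ℝ} (r : ℝ) (hr' : 0 < r')
    (hbd : (S.restrictShell hS hv r' r).boundary.mass ≠ ⊤) : Current (⊤ : Opens V) (d + 1 + 1) :=
  (S.restrictShell hS hv r' r).lipHomotopy (S.mass_restrictShell_ne_top hS hv r' r) hbd
    (S.isCompact_support_restrictShell hS hsupp hv r' r) (h₁.lipschitzWith_ext b hC hr')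
    (h₁.lipschitzWith_ext₂ b h₂ hC hη₀ hclose hr') (sqrt_mul_nonneg n hη₀)
    (h₁.norm_ext₂_sub_ext_le b h₂ hC hη₀ hclose hr') ⊤

/-- `H_r` computed with the finer pair `(G¹_{r'}, G²_{r'})`. [cite: Federer1969, 4.2.2] -/
theorem Current.admHom_eq_finer {r' r : ℝ} (hr' : 0 < r') (hr : 0 < r) (hle : r' ≤ r)
    (hg : (S.restrictAbove hS hv r).boundary.mass ≠ ⊤) :
    S.admHom b hS hsupp hv h₁ h₂ hC hη₀ hclose hr hg =
      (S.restrictAbove hS hv r).lipHomotopy (S.mass_restrictAbove_ne_top hS hv r) hg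
        (S.isCompact_support_restrictAbove hS hsupp hv r) (h₁.lipschitzWith_ext b hC hr')
        (h₁.lipschitzWith_ext₂ b h₂ hC hη₀ hclose hr') (sqrt_mul_nonneg n hη₀)
        (h₁.norm_ext₂_sub_ext_le b h₂ hC hη₀ hclose hr') ⊤ :=
  (S.restrictAbove hS hv r).lipHomotopy_congr _ hg _ _ _ _ _ _ _ _ _ (isOpen_lt continuous_const hv)
    ((S.support_restrictAbove_subset hS hv r).trans fun x hx => by
      show r / 2 < v x
      have : r ≤ v x := hx
      linarith)
    (h₁.ext_eqOn_ext b hC hr hr' hle) (h₁.ext₂_eqOn_ext₂ b h₂ hC hη₀ hclose hr hr' hle)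

/-- **The shell identity for the homotopies**: `H_{r'} − H_r = H(G¹_{r'}, G²_{r'})(S ⌞ shell)`.
[cite: Federer1969, 4.2.2] -/
theorem Current.admHom_sub_admHom {r' r : ℝ} (hr' : 0 < r') (hr : 0 < r) (hle : r' ≤ r)
    (hg' : (S.restrictAbove hS hv r').boundary.mass ≠ ⊤) (hg : (S.restrictAbove hS hv r).boundary.mass ≠ ⊤) :
    S.admHom b hS hsupp hv h₁ h₂ hC hη₀ hclose hr' hg' - S.admHom b hS hsupp hv h₁ h₂ hC hη₀ hclose hr hg =
      S.admHomShell b hS hsupp hv h₁ h₂ hC hη₀ hclose r hr'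
        (S.mass_boundary_restrictShell_ne_top hS hv hle hg' hg) := by
  rw [S.admHom_eq_finer b hS hsupp hv h₁ h₂ hC hη₀ hclose hr' hr hle hg, sub_eq_iff_eq_add']
  have hbd := S.mass_boundary_restrictShell_ne_top hS hv hle hg' hg
  have key := Current.lipHomotopy_add (Ω' := (⊤ : Opens V))
    (T₁ := S.restrictAbove hS hv r) (T₂ := S.restrictShell hS hv r' r)
    (S.mass_restrictAbove_ne_top hS hv r) hg (S.isCompact_support_restrictAbove hS hsupp hv r)
    (S.mass_restrictShell_ne_top hS hv r' r) hbd (S.isCompact_support_restrictShell hS hsupp hv r' r)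
    (by rw [← S.restrictAbove_eq_add_shell hS hv hle]; exact S.mass_restrictAbove_ne_top hS hv r')
    (by rw [← S.restrictAbove_eq_add_shell hS hv hle]; exact hg')
    (by rw [← S.restrictAbove_eq_add_shell hS hv hle]; exact S.isCompact_support_restrictAbove hS hsupp hv r')
    (h₁.lipschitzWith_ext b hC hr') (h₁.lipschitzWith_ext₂ b h₂ hC hη₀ hclose hr') (sqrt_mul_nonneg n hη₀)
    (h₁.norm_ext₂_sub_ext_le b h₂ hC hη₀ hclose hr')
  unfold Current.admHom Current.admHomShell
  rw [← key]
  congr 1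
  exact S.restrictAbove_eq_add_shell hS hv hle

/-- The homotopy constant `(√n η₀) · 15^{d+1} · (8C√n)^{d+1}`. [cite: Federer1969, 4.2.2] -/
def admHomConst (n : ℕ) (C η₀ : ℝ) (d : ℕ) : ℝ≥0∞ :=
  ENNReal.ofReal (Real.sqrt n * η₀) * 15 ^ (d + 1) * admConst n C d

omit [FiniteDimensional ℝ V] [MeasurableSpace V] [BorelSpace V] in
/-- `admConst < ∞`. [folklore] -/
theorem admConst_ne_top : admConst n C d ≠ ⊤ := ENNReal.pow_ne_top ENNReal.ofReal_ne_top

omit [FiniteDimensional ℝ V] [MeasurableSpace V] [BorelSpace V] in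
/-- `admHomConst < ∞`. [folklore] -/
theorem admHomConst_ne_top : admHomConst n C η₀ d ≠ ⊤ :=
  ENNReal.mul_ne_top (ENNReal.mul_ne_top ENNReal.ofReal_ne_top (ENNReal.pow_ne_top (by simp)))
    admConst_ne_top

omit [NormedAddCommGroup V] [InnerProductSpace ℝ V] [FiniteDimensional ℝ V] [MeasurableSpace V] [BorelSpace V] in
/-- The mass constant of `mass_lipHomotopy_le` for the pair `(G¹_{r'}, G²_{r'})`, compared with the
weight: where `0 < v ≤ 4 r'`,
`ofReal(√n η₀ (5 · max(e, 3e))^{d+1}) ≤ admHomConst · (1/v)^{d+1}` (`e = extConst r'`).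
[cite: Federer1969, 4.2.2] -/
theorem ofReal_homConst_le (hC : 0 ≤ C) (hη₀ : 0 ≤ η₀) {r' : ℝ} (hr' : 0 < r') {x : V} (hv0 : 0 < v x)
    (hx : v x ≤ 4 * r') :
    ENNReal.ofReal (Real.sqrt n * η₀ * (5 * max ((extConst n C r' : ℝ≥0) : ℝ) ((3 * extConst n C r' : ℝ≥0) : ℝ)) ^ (d + 1))
      ≤ admHomConst n C η₀ d * admWeight v d x := by
  have he : max ((extConst n C r' : ℝ≥0) : ℝ) ((3 * extConst n C r' : ℝ≥0) : ℝ) = 3 * (extConst n C r' : ℝ) := by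
    push_cast
    exact max_eq_right (by linarith [(extConst n C r').coe_nonneg])
  have h15e : ENNReal.ofReal ((15 * (extConst n C r' : ℝ)) ^ (d + 1)) =
      15 ^ (d + 1) * (extConst n C r' : ℝ≥0∞) ^ (d + 1) := by
    rw [ENNReal.ofReal_pow (by positivity), ENNReal.ofReal_mul (by norm_num), ENNReal.ofReal_coe_nnreal,
      mul_pow, ENNReal.ofReal_ofNat]
  rw [he, show 5 * (3 * (extConst n C r' : ℝ)) = 15 * (extConst n C r' : ℝ) by ring,
    ENNReal.ofReal_mul (sqrt_mul_nonneg n hη₀), h15e]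
  calc ENNReal.ofReal (Real.sqrt n * η₀) * (15 ^ (d + 1) * (extConst n C r' : ℝ≥0∞) ^ (d + 1))
      ≤ ENNReal.ofReal (Real.sqrt n * η₀) * (15 ^ (d + 1) * (admConst n C d * admWeight v d x)) := by
        gcongr
        exact extConst_pow_le_admConst_mul hC hr' hv0 hx
    _ = admHomConst n C η₀ d * admWeight v d x := by
        unfold admHomConst; ring

/-- **The shell family of the admissible homotopy** `Ψ_r = H_r`, `K = admHomConst`,
`w = (1/v)^{d+1}`. [cite: Federer1969, 4.2.2] -/
def Current.admHomFamily : S.ShellFamily hS hv (d + 1 + 1) where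
  Ψ r hr hgood := S.admHom b hS hsupp hv h₁ h₂ hC hη₀ hclose hr hgood
  K := admHomConst n C η₀ d
  w := admWeight v d
  K_ne_top := admHomConst_ne_top
  measurable_w := measurable_admWeight hv
  shell {r' r} hr' hr hle h4 hg' hg := by
    rw [S.admHom_sub_admHom b hS hsupp hv h₁ h₂ hC hη₀ hclose hr' hr hle hg' hg]
    unfold Current.admHomShell
    refine (Current.mass_lipHomotopy_le _ _ _ _ _ _ _ _).trans ?_
    calc _ ≤ ENNReal.ofReal (Real.sqrt n * η₀ * (5 * max ((extConst n C r' : ℝ≥0) : ℝ)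
            ((3 * extConst n C r' : ℝ≥0) : ℝ)) ^ (d + 1)) * S.variation {x | r' < v x ∧ v x ≤ r} :=
          mul_le_mul' le_rfl ((S.isRepresentable_of_mass_ne_top hS).mass_restrictSet_le _)
      _ = ∫⁻ _ in {x | r' < v x ∧ v x ≤ r}, ENNReal.ofReal (Real.sqrt n * η₀ * (5 * max ((extConst n C r' : ℝ≥0) : ℝ)
            ((3 * extConst n C r' : ℝ≥0) : ℝ)) ^ (d + 1)) ∂S.variation := (setLIntegral_const _ _).symm
      _ ≤ ∫⁻ x in {x | r' < v x ∧ v x ≤ r}, admHomConst n C η₀ d * admWeight v d x ∂S.variation :=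
          setLIntegral_mono (measurable_const.mul (measurable_admWeight hv)) fun x hx =>
            ofReal_homConst_le hC hη₀ hr' (hr'.trans hx.1) (hx.2.trans h4)
      _ = admHomConst n C η₀ d * ∫⁻ x in {x | r' < v x ∧ v x ≤ r}, admWeight v d x ∂S.variation :=
          lintegral_const_mul _ (measurable_admWeight hv)
  top {r} hr hv4 hg := by
    unfold Current.admHom
    refine (Current.mass_lipHomotopy_le _ _ _ _ _ _ _ _).trans ?_
    calc _ ≤ ENNReal.ofReal (Real.sqrt n * η₀ * (5 * max ((extConst n C r : ℝ≥0) : ℝ)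
            ((3 * extConst n C r : ℝ≥0) : ℝ)) ^ (d + 1)) * S.variation {x | r < v x} :=
          mul_le_mul' le_rfl ((S.isRepresentable_of_mass_ne_top hS).mass_restrictSet_le _)
      _ = ∫⁻ _ in {x | r < v x}, ENNReal.ofReal (Real.sqrt n * η₀ * (5 * max ((extConst n C r : ℝ≥0) : ℝ)
            ((3 * extConst n C r : ℝ≥0) : ℝ)) ^ (d + 1)) ∂S.variation := (setLIntegral_const _ _).symm
      _ ≤ ∫⁻ x in {x | r < v x}, admHomConst n C η₀ d * admWeight v d x ∂S.variation :=
          setLIntegral_mono (measurable_const.mul (measurable_admWeight hv)) fun x hx =>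
            ofReal_homConst_le hC hη₀ hr (hr.trans hx) (hv4 x)
      _ = admHomConst n C η₀ d * ∫⁻ x in {x | r < v x}, admWeight v d x ∂S.variation :=
          lintegral_const_mul _ (measurable_admWeight hv)

variable {ε : ℝ} (hε : 0 < ε) {P : ℝ → Prop} (R : S.GoodSeq hS hv ε P) (hvε : ∀ x, v x ≤ ε)
  (hI : ∫⁻ x, admWeight v d x ∂S.variation ≠ ⊤)

/-- **The admissible homotopy `H_v(g₁, g₂) S`** [Federer1969, 4.2.2:
"`H_u(f, g) T = lim_{r→0+} h_#([0,1] × T ⌞ U_r)`"]. [cite: Federer1969, 4.2.2] -/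
def Current.admHomLim : Current (⊤ : Opens V) (d + 1 + 1) :=
  (S.admHomFamily b hS hsupp hv h₁ h₂ hC hη₀ hclose).lim hε R hvε hI

/-- `H_{r_j}(ψ) → H_v(g₁, g₂) S (ψ)`. [cite: Federer1969, 4.2.2] -/
theorem Current.tendsto_admHom (ψ : TestForm (⊤ : Opens V) (d + 1 + 1)) :
    Tendsto (fun j => S.admHom b hS hsupp hv h₁ h₂ hC hη₀ hclose (R.pos hε j) (R.good j) ψ) atTop
      (𝓝 (S.admHomLim b hS hsupp hv h₁ h₂ hC hη₀ hclose hε R hvε hI ψ)) :=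
  (S.admHomFamily b hS hsupp hv h₁ h₂ hC hη₀ hclose).tendsto_seq hε R hI hvε ψ

/-- **`𝐌(H_v(g₁,g₂) S) ≤ (√n η₀) 15^{d+1} (8C√n)^{d+1} ∫ (1/v)^{d+1} d‖S‖`** [Federer1969, 4.2.2:
"`𝐌[H_u(f,g) T] ≤ sup{|f(x) − g(x)|} ‖T‖(u^{-m})`"]. [cite: Federer1969, 4.2.2] -/
theorem Current.mass_admHomLim_le :
    (S.admHomLim b hS hsupp hv h₁ h₂ hC hη₀ hclose hε R hvε hI).mass ≤
      admHomConst n C η₀ d * ∫⁻ x, admWeight v d x ∂S.variation :=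
  (S.admHomFamily b hS hsupp hv h₁ h₂ hC hη₀ hclose).mass_lim_le hε R hI hvε

/-- **`H_v(g₁,g₂) S` does not depend on the good sequence.** [cite: Federer1969, 4.2.2] -/
theorem Current.admHomLim_eq {P' : ℝ → Prop} (R' : S.GoodSeq hS hv ε P') :
    S.admHomLim b hS hsupp hv h₁ h₂ hC hη₀ hclose hε R hvε hI =
      S.admHomLim b hS hsupp hv h₁ h₂ hC hη₀ hclose hε R' hvε hI :=
  (S.admHomFamily b hS hsupp hv h₁ h₂ hC hη₀ hclose).lim_eq hε R hI hvε (fun _ hx => admWeight_eq_top hx) R'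

end AdmissibleHomotopy

/-! ## Boundary behaviour of the admissible push-forward — Part C0: slice majorants, selections -/

section SliceMajorant

variable {E : Type*} [NormedAddCommGroup E] [NormedSpace ℝ E] [FiniteDimensional ℝ E]
  [MeasurableSpace E] [BorelSpace E] {Ω : Opens E} {k : ℕ}

/-- **A measurable majorant of the slice masses** by a Lipschitz function: there is a measurable
`G ≥ 𝐌⟨T, f, ·+⟩` a.e. with `∫_{(a,b)} G ≤ C_k L ‖T‖(f⁻¹[a − δ, b + δ])` for all `a, b` and `δ > 0`
(the `liminf` of the smooth window majorants along smooth `L`-Lipschitz approximants of `f`; cf.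
`lintegral_mass_slice_le_of_lipschitz`). [cite: Federer1969, 4.2.1] -/
theorem Current.IsRepresentable.exists_measurable_slice_majorant {T : Current Ω (k + 1)}
    (hT : T.IsRepresentable) (hdT : T.boundary.IsRepresentable) {f : E → ℝ} {L : ℝ≥0}
    (hf : LipschitzWith L f) :
    ∃ G : ℝ → ℝ≥0∞, Measurable G ∧ (∀ᵐ r ∂(volume : Measure ℝ), (hT.slice hdT hf.continuous r).mass ≤ G r) ∧
      ∀ (a b : ℝ) {δ : ℝ}, 0 < δ → ∫⁻ r in Set.Ioo a b, G r ≤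
        ENNReal.ofReal (sliceConst k) * ENNReal.ofReal L * T.variation (f ⁻¹' Set.Icc (a - δ) (b + δ)) := by
  obtain ⟨g, hg, hDg, hdist⟩ := exists_smooth_approx hf one_pos
  have hgc : ∀ j, Continuous (g j) := fun j => (hg j).continuous
  have hlim : ∀ x, Tendsto (fun j => g j x) atTop (𝓝 (f x)) := tendsto_of_dist_le_div hdist
  set Gj : ℕ → ℝ → ℝ≥0∞ := fun j r => liminf (fun n => sliceWindow T (g j) n r) atTop
  have hGjm : ∀ j, Measurable (Gj j) := fun j => Measurable.liminf fun n => measurable_sliceWindow hT (hg j) n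
  refine ⟨fun r => liminf (fun j => Gj j r) atTop, Measurable.liminf hGjm, ?_, fun a b δ hδ => ?_⟩
  · filter_upwards [hT.ae_variation_level_eq_zero hf.continuous,
      hdT.ae_variation_level_eq_zero hf.continuous] with r hr hdr
    refine (hT.mass_slice_le_liminf_of_tendsto hdT hf.continuous hgc hlim hr hdr).trans ?_
    exact liminf_le_liminf (Eventually.of_forall fun j => hT.mass_slice_le_liminf hdT (hg j) r)
  · -- eventually `1/(j+1) ≤ δ/2`
    have hev : ∀ᶠ j : ℕ in atTop, 1 / ((j : ℝ) + 1) ≤ δ / 2 := by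
      have := tendsto_one_div_add_atTop_nhds_zero_nat.eventually (Iic_mem_nhds (half_pos hδ))
      exact this
    calc ∫⁻ r in Set.Ioo a b, liminf (fun j => Gj j r) atTop
        ≤ liminf (fun j => ∫⁻ r in Set.Ioo a b, Gj j r) atTop := lintegral_liminf_le fun j => hGjm j
      _ ≤ ENNReal.ofReal (sliceConst k) * ENNReal.ofReal L * T.variation (f ⁻¹' Set.Icc (a - δ) (b + δ)) := by
          refine liminf_le_of_frequently_le' (hev.frequently.mono fun j hj => ?_)
          refine (hT.lintegral_liminf_sliceWindow_le (hg j) a b (half_pos hδ)).trans ?_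
          rw [mul_assoc]
          refine mul_le_mul' le_rfl ?_
          calc ∫⁻ x in g j ⁻¹' Set.Icc a (b + δ / 2), ‖fderiv ℝ (g j) x‖ₑ ∂T.variation
              ≤ ∫⁻ _ in g j ⁻¹' Set.Icc a (b + δ / 2), ENNReal.ofReal L ∂T.variation :=
                lintegral_mono fun x => by rw [← ofReal_norm]; exact ENNReal.ofReal_le_ofReal (hDg j x)
            _ = ENNReal.ofReal L * T.variation (g j ⁻¹' Set.Icc a (b + δ / 2)) := by rw [setLIntegral_const]
            _ ≤ ENNReal.ofReal L * T.variation (f ⁻¹' Set.Icc (a - δ) (b + δ)) := by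
                refine mul_le_mul' le_rfl (measure_mono fun x hx => ?_)
                simp only [Set.mem_preimage, Set.mem_Icc] at hx ⊢
                have hd := hdist j x
                rw [Real.dist_eq, abs_le] at hd
                constructor <;> linarith [hd.1, hd.2]

end SliceMajorant

section GoodSeqFrequently

open Cubical

variable {V : Type*} [NormedAddCommGroup V] [InnerProductSpace ℝ V] [FiniteDimensional ℝ V]
  [MeasurableSpace V] [BorelSpace V] {d : ℕ} {v : V → ℝ} {S : Current (⊤ : Opens V) (d + 1)}

/-- **Good sequences with a prescribed frequent property**: if in each dyadic interval the property
`P` holds on a set of positive measure, there is a good sequence with `P (r_j)` for all `j`.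
[cite: Federer1969, 4.2.2] -/
theorem Current.exists_goodSeq_of_frequently (hS : S.mass ≠ ⊤) (hdS : S.boundary.mass ≠ ⊤) {L : ℝ≥0}
    (hv : LipschitzWith L v) {ε : ℝ} {P : ℝ → Prop}
    (hP : ∀ j : ℕ, ∃ᵐ r ∂(volume : Measure ℝ), r ∈ Set.Ioc (ε / 2 ^ (j + 1)) (ε / 2 ^ j) ∧ P r) :
    Nonempty (S.GoodSeq hS hv.continuous ε P) := by
  have hT := S.isRepresentable_of_mass_ne_top hS
  have hdT := S.boundary.isRepresentable_of_mass_ne_top hdS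
  have hgood := hT.ae_mass_boundary_restrictSet_lt_top hdT hv hS hdS
  have hex : ∀ j : ℕ, ∃ r, (r ∈ Set.Ioc (ε / 2 ^ (j + 1)) (ε / 2 ^ j) ∧ P r) ∧
      (hT.restrictSet {x | r < v x} (measurableSet_lt_of_continuous hv.continuous r)).boundary.mass < ⊤ :=
    fun j => ((hP j).and_eventually hgood).exists
  choose r hr hgr using hex
  exact ⟨⟨r, fun j => (hr j).1.1, fun j => (hr j).1.2, fun j => (hgr j).ne, fun j => (hr j).2⟩⟩

/-- **Positive measure from a measure bound**: if `volume {r ∈ I | ¬ P r} < volume I` then `P`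
holds frequently on `I`. [folklore] -/
theorem frequently_of_measure_compl_lt {I : Set ℝ} {P : ℝ → Prop}
    (h : volume {r | r ∈ I ∧ ¬ P r} < volume I) :
    ∃ᵐ r ∂(volume : Measure ℝ), r ∈ I ∧ P r := by
  rw [frequently_ae_iff]
  intro h0
  have hsub : I ⊆ {r | r ∈ I ∧ ¬ P r} ∪ {r | r ∈ I ∧ P r} := fun r hr => by
    by_cases hp : P r
    · exact Or.inr ⟨hr, hp⟩
    · exact Or.inl ⟨hr, hp⟩
  have := (measure_mono (μ := (volume : Measure ℝ)) hsub).trans (measure_union_le _ _)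
  rw [h0, add_zero] at this
  exact (not_le.2 h) this

end GoodSeqFrequently

/-! ## Part C1: good sequences with slice decay -/

section SliceDecay

open Cubical

variable {V : Type*} [NormedAddCommGroup V] [InnerProductSpace ℝ V] [FiniteDimensional ℝ V]
  [MeasurableSpace V] [BorelSpace V] {n d : ℕ} {v : V → ℝ} {C : ℝ}
  {S : Current (⊤ : Opens V) (d + 1 + 1)}

/-- `‖S‖{v ≤ c/2^j} → 0` when `‖S‖{v ≤ 0} = 0`. [folklore] -/
theorem Current.tendsto_variation_sublevel_of_null {k : ℕ} (T : Current (⊤ : Opens V) k) (hT : T.mass ≠ ⊤)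
    (hv : Continuous v) {c : ℝ} (hc : 0 < c) (h0 : T.variation {x | v x ≤ 0} = 0) :
    Tendsto (fun j : ℕ => T.variation {x | v x ≤ c / 2 ^ j}) atTop (𝓝 0) := by
  have hanti : Antitone fun j : ℕ => {x | v x ≤ c / 2 ^ j} := by
    intro i j hij x (hx : v x ≤ c / 2 ^ j)
    show v x ≤ c / 2 ^ i
    exact hx.trans (div_le_div_of_nonneg_left hc.le (by positivity) (pow_le_pow_right₀ (by norm_num) hij))
  have h := tendsto_measure_iInter_atTop (μ := T.variation)
    (fun j => (isClosed_le hv continuous_const).measurableSet.nullMeasurableSet) hanti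
    ⟨0, ne_top_of_le_ne_top hT (T.variation_le_mass _)⟩
  have hinter : ⋂ j : ℕ, {x | v x ≤ c / 2 ^ j} = {x | v x ≤ 0} := by
    ext x
    simp only [Set.mem_iInter, Set.mem_setOf_eq]
    constructor
    · intro h
      by_contra hpos
      push Not at hpos
      obtain ⟨j, hj⟩ : ∃ j : ℕ, c / 2 ^ j < v x := by
        have ht : Tendsto (fun j : ℕ => c / 2 ^ j) atTop (𝓝 0) := by
          have := (tendsto_pow_atTop_nhds_zero_of_lt_one (by norm_num : (0:ℝ) ≤ 1 / 2) (by norm_num)).const_mul c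
          rw [mul_zero] at this
          refine this.congr fun j => ?_
          rw [one_div, inv_pow, div_eq_mul_inv]
        exact (ht.eventually (gt_mem_nhds hpos)).exists
      exact (not_le.2 hj) (h j)
    · intro h j
      exact h.trans (by positivity)
  rw [hinter, h0] at h
  exact h

/-- Dyadic intervals `(ε/2^{j+1}, ε/2^j]` are disjoint: membership determines `j`. [folklore] -/
theorem dyadic_unique {ε : ℝ} (hε : 0 < ε) {r : ℝ} {i j : ℕ}
    (hi : r ∈ Set.Ioc (ε / 2 ^ (i + 1)) (ε / 2 ^ i)) (hj : r ∈ Set.Ioc (ε / 2 ^ (j + 1)) (ε / 2 ^ j)) : i = j := by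
  by_contra hne
  wlog hlt : i < j generalizing i j
  · exact this hj hi (Ne.symm hne) (lt_of_le_of_ne (not_lt.1 hlt) (Ne.symm hne))
  have h1 : ε / 2 ^ j ≤ ε / 2 ^ (i + 1) :=
    div_le_div_of_nonneg_left hε.le (by positivity) (pow_le_pow_right₀ (by norm_num) (Nat.succ_le_of_lt hlt))
  linarith [hi.1, hj.2]

variable (hS : S.mass ≠ ⊤) (hdS : S.boundary.mass ≠ ⊤) (hv : LipschitzWith 1 v) {ε : ℝ} (hε : 0 < ε)
  (hI : ∫⁻ x, admWeight v (d + 1) x ∂S.variation ≠ ⊤)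

include hS hv hε hI in
/-- The tail weights `W_j = ∫_{v ≤ 2ε/2^j} (1/v)^{d+2} d‖S‖ → 0`. [folklore] -/
theorem Current.tendsto_tailWeight :
    Tendsto (fun j : ℕ => ∫⁻ x in {x | v x ≤ 2 * ε / 2 ^ j}, admWeight v (d + 1) x ∂S.variation) atTop (𝓝 0) := by
  have h0 : S.variation {x | v x ≤ 0} = 0 := by
    by_contra hne
    apply hI
    refine eq_top_iff.2 (le_trans ?_ (setLIntegral_le_lintegral {x | v x ≤ 0} _))
    have : ∫⁻ x in {x | v x ≤ 0}, admWeight v (d + 1) x ∂S.variation = ∫⁻ _ in {x | v x ≤ 0}, ⊤ ∂S.variation :=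
      setLIntegral_congr_fun (isClosed_le hv.continuous continuous_const).measurableSet fun x hx =>
        admWeight_eq_top hx
    rw [this, setLIntegral_const, ENNReal.top_mul hne]
  exact tendsto_setLIntegral_zero (μ := S.variation) hI
    (S.tendsto_variation_sublevel_of_null hS hv.continuous (by positivity : 0 < 2 * ε) h0)

include hv in
/-- **Weighted bound of a sublevel mass**: `‖S‖{v ≤ c} ≤ c^{d+2} ∫_{v ≤ c} (1/v)^{d+2} d‖S‖` (`c > 0`;
`‖S‖{v ≤ 0} = 0`). [cite: Federer1969, 4.2.2] -/
theorem Current.variation_sublevel_le_weighted {c : ℝ} (hc : 0 < c) :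
    S.variation {x | v x ≤ c} ≤ ENNReal.ofReal (c ^ (d + 2)) * ∫⁻ x in {x | v x ≤ c}, admWeight v (d + 1) x ∂S.variation := by
  rw [← lintegral_const_mul _ (measurable_admWeight hv.continuous), ← setLIntegral_one]
  refine setLIntegral_mono (measurable_const.mul (measurable_admWeight hv.continuous)) fun x hx => ?_
  have hx' : v x ≤ c := hx
  -- `1 ≤ c^{d+2} (1/v)^{d+2}` where `v ≤ c` (both sides `∞`-safe)
  unfold admWeight
  rcases le_or_gt (v x) 0 with h0 | hpos
  · rw [ENNReal.ofReal_of_nonpos h0, ENNReal.inv_zero, ENNReal.top_pow (Nat.succ_ne_zero _),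
      ENNReal.mul_top (by positivity : ENNReal.ofReal (c ^ (d + 2)) ≠ 0)]
    exact le_top
  · rw [← ENNReal.ofReal_inv_of_pos hpos, ← ENNReal.ofReal_pow (by positivity), ← ENNReal.ofReal_mul (by positivity),
      ← ENNReal.ofReal_one]
    refine ENNReal.ofReal_le_ofReal ?_
    rw [← mul_pow, show (1 : ℝ) = 1 ^ (d + 1 + 1) by simp]
    refine pow_le_pow_left₀ zero_le_one ?_ _
    rw [le_mul_inv_iff₀ hpos, one_mul]
    exact hx'

omit [FiniteDimensional ℝ V] [MeasurableSpace V] [BorelSpace V] in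
/-- `(extConst r)^{d+1} ℓ^{d+1} ≤ (2√n C)^{d+1}` for `0 < ℓ ≤ r`. [folklore] -/
theorem extConst_pow_mul_le (hC : 0 ≤ C) {r ℓ : ℝ} (hr : 0 < r) (hℓ : 0 < ℓ) (hℓr : ℓ ≤ r) :
    (extConst n C r : ℝ≥0∞) ^ (d + 1) * ENNReal.ofReal (ℓ ^ (d + 1)) ≤
      ENNReal.ofReal ((2 * Real.sqrt n * C) ^ (d + 1)) := by
  have he : (extConst n C r : ℝ≥0∞) = ENNReal.ofReal (Real.sqrt n * (C / (r / 2))) := by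
    rw [← ENNReal.ofReal_coe_nnreal]
    unfold extConst
    rw [NNReal.coe_mul, Real.coe_sqrt, NNReal.coe_natCast, Real.coe_toNNReal _ (div_nonneg hC (half_pos hr).le)]
  rw [he, ← ENNReal.ofReal_pow (by positivity), ← ENNReal.ofReal_mul (by positivity), ← mul_pow]
  refine ENNReal.ofReal_le_ofReal (pow_le_pow_left₀ (by positivity) ?_ _)
  rw [show Real.sqrt n * (C / (r / 2)) * ℓ = 2 * Real.sqrt n * C * (ℓ / r) by field_simp]
  have : ℓ / r ≤ 1 := (div_le_one hr).2 hℓr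
  have h0 : 0 ≤ 2 * Real.sqrt n * C := by positivity
  nlinarith

include hS hdS hε hI in
/-- **Good sequences with slice decay**: for a normal `S` with `∫ (1/v)^{d+2} d‖S‖ < ∞` there is a good
sequence along which `(extConst r_j)^{d+1} 𝐌⟨S, v, r_j+⟩ → 0`, satisfying moreover any prescribed
a.e. property `Q` [Federer1969, 4.2.2: "`lim inf_{r→0+} r^{1-m} 𝐌⟨T, u, r+⟩ = 0`"]. The radii are
selected in the dyadic intervals by Markov's inequality applied to a measurable slice majorant.
[cite: Federer1969, 4.2.2] -/
theorem Current.exists_goodSeq_decay (hC : 0 ≤ C) {Q : ℝ → Prop} (hQ : ∀ᵐ r ∂(volume : Measure ℝ), Q r) :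
    ∃ (P : ℝ → Prop) (R : S.GoodSeq hS hv.continuous ε P), (∀ j, Q (R.r j)) ∧
      Tendsto (fun j => (extConst n C (R.r j) : ℝ≥0∞) ^ (d + 1) *
        ((S.isRepresentable_of_mass_ne_top hS).slice (S.boundary.isRepresentable_of_mass_ne_top hdS)
          hv.continuous (R.r j)).mass) atTop (𝓝 0) := by
  obtain ⟨G, hGm, hGae, hGint⟩ := (S.isRepresentable_of_mass_ne_top hS).exists_measurable_slice_majorant
    (S.boundary.isRepresentable_of_mass_ne_top hdS) hv
  -- data
  have hℓpos : ∀ j : ℕ, 0 < ε / 2 ^ (j + 1) := fun j => by positivity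
  have hℓ2 : ∀ j : ℕ, ε / 2 ^ j = 2 * (ε / 2 ^ (j + 1)) := fun j => by rw [pow_succ]; field_simp
  have hℓ4 : ∀ j : ℕ, 4 * (ε / 2 ^ (j + 1)) = 2 * ε / 2 ^ j := fun j => by rw [pow_succ]; field_simp; ring
  set W : ℕ → ℝ≥0∞ := fun j => ∫⁻ x in {x | v x ≤ 2 * ε / 2 ^ j}, admWeight v (d + 1) x ∂S.variation with hW
  have hWfin : ∀ j, W j ≠ ⊤ := fun j => ne_top_of_le_ne_top hI (setLIntegral_le_lintegral _ _)
  set cS : ℝ≥0∞ := ENNReal.ofReal (sliceConst (d + 1)) * ENNReal.ofReal ((1 : ℝ≥0) : ℝ) with hcS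
  have hcSfin : cS ≠ ⊤ := ENNReal.mul_ne_top ENNReal.ofReal_ne_top ENNReal.ofReal_ne_top
  set κ : ℕ → ℝ≥0∞ := fun j => 4 ^ (d + 3) * (cS * W j) + ENNReal.ofReal (1 / 2 ^ j) with hκ
  set θ : ℕ → ℝ≥0∞ := fun j => ENNReal.ofReal ((ε / 2 ^ (j + 1)) ^ (d + 1)) * κ j with hθ
  -- the integral of `G` over `I_j`
  have hGI : ∀ j : ℕ, ∫⁻ r in Set.Ioc (ε / 2 ^ (j + 1)) (ε / 2 ^ j), G r ≤
      4 ^ (d + 2) * (ENNReal.ofReal ((ε / 2 ^ (j + 1)) ^ (d + 2)) * (cS * W j)) := by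
    intro j
    rw [← setLIntegral_congr Ioo_ae_eq_Ioc]
    refine (hGint _ _ (hℓpos j)).trans ?_
    have hsub : v ⁻¹' Set.Icc (ε / 2 ^ (j + 1) - ε / 2 ^ (j + 1)) (ε / 2 ^ j + ε / 2 ^ (j + 1)) ⊆
        {x | v x ≤ 4 * (ε / 2 ^ (j + 1))} := fun x hx => by
      simp only [Set.mem_preimage, Set.mem_Icc] at hx
      show v x ≤ 4 * (ε / 2 ^ (j + 1))
      linarith [hx.2, hℓ2 j, hℓpos j]
    calc cS * S.variation (v ⁻¹' Set.Icc (ε / 2 ^ (j + 1) - ε / 2 ^ (j + 1)) (ε / 2 ^ j + ε / 2 ^ (j + 1)))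
        ≤ cS * S.variation {x | v x ≤ 4 * (ε / 2 ^ (j + 1))} := mul_le_mul' le_rfl (measure_mono hsub)
      _ ≤ cS * (ENNReal.ofReal ((4 * (ε / 2 ^ (j + 1))) ^ (d + 2)) *
            ∫⁻ x in {x | v x ≤ 4 * (ε / 2 ^ (j + 1))}, admWeight v (d + 1) x ∂S.variation) :=
          mul_le_mul' le_rfl (S.variation_sublevel_le_weighted hv (by positivity))
      _ = 4 ^ (d + 2) * (ENNReal.ofReal ((ε / 2 ^ (j + 1)) ^ (d + 2)) * (cS * W j)) := by
          rw [mul_pow, ENNReal.ofReal_mul (by positivity), ENNReal.ofReal_pow (by norm_num : (0:ℝ) ≤ 4),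
            ENNReal.ofReal_ofNat, hℓ4 j]
          simp only [hW]
          ring
  -- Markov: `G < θ_j` frequently on `I_j`
  have hfreq : ∀ j : ℕ, ∃ᵐ r ∂(volume : Measure ℝ), r ∈ Set.Ioc (ε / 2 ^ (j + 1)) (ε / 2 ^ j) ∧ G r < θ j := by
    intro j
    apply frequently_of_measure_compl_lt
    have hIvol : volume (Set.Ioc (ε / 2 ^ (j + 1)) (ε / 2 ^ j)) = ENNReal.ofReal (ε / 2 ^ (j + 1)) := by
      rw [Real.volume_Ioc]; congr 1; linarith [hℓ2 j]
    rw [hIvol]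
    by_contra hge
    rw [not_lt] at hge
    have hM := mul_meas_ge_le_lintegral (μ := volume.restrict (Set.Ioc (ε / 2 ^ (j + 1)) (ε / 2 ^ j))) hGm (θ j)
    have h1 : ENNReal.ofReal (ε / 2 ^ (j + 1)) ≤
        (volume.restrict (Set.Ioc (ε / 2 ^ (j + 1)) (ε / 2 ^ j))) {r | θ j ≤ G r} := by
      rw [Measure.restrict_apply (measurableSet_le measurable_const hGm)]
      refine hge.trans (measure_mono fun r hr => ⟨?_, hr.1⟩)
      exact not_lt.1 hr.2
    have h2 : θ j * ENNReal.ofReal (ε / 2 ^ (j + 1)) ≤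
        4 ^ (d + 2) * (ENNReal.ofReal ((ε / 2 ^ (j + 1)) ^ (d + 2)) * (cS * W j)) :=
      (mul_le_mul' le_rfl h1).trans (hM.trans (hGI j))
    -- rewrite the left side
    set X := ENNReal.ofReal ((ε / 2 ^ (j + 1)) ^ (d + 2)) * (cS * W j) with hX
    have hXfin : X ≠ ⊤ := ENNReal.mul_ne_top ENNReal.ofReal_ne_top (ENNReal.mul_ne_top hcSfin (hWfin j))
    set Y := ENNReal.ofReal ((ε / 2 ^ (j + 1)) ^ (d + 2)) * ENNReal.ofReal (1 / 2 ^ j) with hY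
    have hY0 : Y ≠ 0 := mul_ne_zero (ENNReal.ofReal_pos.2 (by positivity)).ne' (ENNReal.ofReal_pos.2 (by positivity)).ne'
    have hmul : ENNReal.ofReal ((ε / 2 ^ (j + 1)) ^ (d + 1)) * ENNReal.ofReal (ε / 2 ^ (j + 1)) =
        ENNReal.ofReal ((ε / 2 ^ (j + 1)) ^ (d + 2)) := by
      rw [← ENNReal.ofReal_mul (by positivity), ← pow_succ]
    have hLHS : θ j * ENNReal.ofReal (ε / 2 ^ (j + 1)) = 4 ^ (d + 3) * X + Y := by
      have h' : θ j * ENNReal.ofReal (ε / 2 ^ (j + 1)) = ENNReal.ofReal ((ε / 2 ^ (j + 1)) ^ (d + 2)) * κ j := by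
        simp only [hθ]
        rw [mul_right_comm, hmul]
      rw [h']
      simp only [hκ, hX, hY]
      ring
    rw [hLHS] at h2
    have h3 : 4 ^ (d + 2) * X < 4 ^ (d + 3) * X + Y := by
      calc 4 ^ (d + 2) * X ≤ 4 ^ (d + 3) * X :=
            mul_le_mul' (pow_le_pow_right₀ (by norm_num : (1 : ℝ≥0∞) ≤ 4) (Nat.le_succ _)) le_rfl
        _ < 4 ^ (d + 3) * X + Y := ENNReal.lt_add_right (ENNReal.mul_ne_top (ENNReal.pow_ne_top (by simp)) hXfin) hY0
    exact (lt_irrefl _) (h3.trans_le h2)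
  -- the good sequence
  set P : ℝ → Prop := fun r => (∀ j : ℕ, r ∈ Set.Ioc (ε / 2 ^ (j + 1)) (ε / 2 ^ j) → G r < θ j) ∧ Q r ∧
    ((S.isRepresentable_of_mass_ne_top hS).slice (S.boundary.isRepresentable_of_mass_ne_top hdS)
      hv.continuous r).mass ≤ G r with hP
  have hfreqP : ∀ j : ℕ, ∃ᵐ r ∂(volume : Measure ℝ), r ∈ Set.Ioc (ε / 2 ^ (j + 1)) (ε / 2 ^ j) ∧ P r := by
    intro j
    refine ((hfreq j).and_eventually (hQ.and hGae)).mono fun r hr => ⟨hr.1.1, fun j' hj' => ?_, hr.2.1, hr.2.2⟩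
    rw [dyadic_unique hε hj' hr.1.1]
    exact hr.1.2
  obtain ⟨R⟩ := S.exists_goodSeq_of_frequently hS hdS hv hfreqP
  refine ⟨P, R, fun j => (R.prop j).2.1, ?_⟩
  -- decay
  have hκ0 : Tendsto κ atTop (𝓝 0) := by
    have h1 : Tendsto (fun j => 4 ^ (d + 3) * (cS * W j)) atTop (𝓝 0) := by
      have hW0 := S.tendsto_tailWeight hS hv hε hI
      have := ENNReal.Tendsto.const_mul (a := 4 ^ (d + 3) * cS) hW0
        (Or.inr (ENNReal.mul_ne_top (ENNReal.pow_ne_top (by simp)) hcSfin))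
      simp only [mul_zero] at this
      simpa [mul_assoc] using this
    have h2 : Tendsto (fun j : ℕ => ENNReal.ofReal (1 / 2 ^ j)) atTop (𝓝 0) := by
      rw [← ENNReal.ofReal_zero]
      refine ENNReal.tendsto_ofReal ?_
      have := tendsto_pow_atTop_nhds_zero_of_lt_one (by norm_num : (0:ℝ) ≤ 1 / 2) (by norm_num)
      exact this.congr fun j => by rw [one_div, inv_pow, one_div]
    rw [show (0 : ℝ≥0∞) = 0 + 0 by simp]
    exact h1.add h2
  have hbound : ∀ j, (extConst n C (R.r j) : ℝ≥0∞) ^ (d + 1) *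
      ((S.isRepresentable_of_mass_ne_top hS).slice (S.boundary.isRepresentable_of_mass_ne_top hdS)
        hv.continuous (R.r j)).mass ≤ ENNReal.ofReal ((2 * Real.sqrt n * C) ^ (d + 1)) * κ j := by
    intro j
    have hPj := R.prop j
    have hGθ : G (R.r j) < θ j := hPj.1 j ⟨R.lower j, R.upper j⟩
    calc _ ≤ (extConst n C (R.r j) : ℝ≥0∞) ^ (d + 1) * θ j :=
          mul_le_mul' le_rfl (hPj.2.2.trans hGθ.le)
      _ = (extConst n C (R.r j) : ℝ≥0∞) ^ (d + 1) * ENNReal.ofReal ((ε / 2 ^ (j + 1)) ^ (d + 1)) * κ j := by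
          simp only [hθ, mul_assoc]
      _ ≤ ENNReal.ofReal ((2 * Real.sqrt n * C) ^ (d + 1)) * κ j :=
          mul_le_mul' (extConst_pow_mul_le hC (R.pos hε j) (hℓpos j) (R.lower j).le) le_rfl
  have hlim : Tendsto (fun j => ENNReal.ofReal ((2 * Real.sqrt n * C) ^ (d + 1)) * κ j) atTop (𝓝 0) := by
    have := ENNReal.Tendsto.const_mul (a := ENNReal.ofReal ((2 * Real.sqrt n * C) ^ (d + 1))) hκ0
      (Or.inr ENNReal.ofReal_ne_top)
    rwa [mul_zero] at this
  exact tendsto_of_tendsto_of_tendsto_of_le_of_le tendsto_const_nhds hlim (fun j => bot_le) hbound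

end SliceDecay

/-! ## Part C2: `∂ (g_{#v} S) = g_{#v} (∂S)` -/

section BoundaryCommutes

open Cubical

variable {V : Type*} [NormedAddCommGroup V] [InnerProductSpace ℝ V] [FiniteDimensional ℝ V]
  [MeasurableSpace V] [BorelSpace V] {n d : ℕ} {v : V → ℝ} {g : V → V} {C : ℝ}
  {S : Current (⊤ : Opens V) (d + 1 + 1)}

/-- A good sequence for `S` whose radii are also good for `∂S` is a good sequence for `∂S`.
[folklore] -/
def Current.GoodSeq.toBoundary {hS : S.mass ≠ ⊤} {hv : Continuous v} {ε : ℝ} {P : ℝ → Prop}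
    (R : S.GoodSeq hS hv ε P) (hdS : S.boundary.mass ≠ ⊤)
    (hgood : ∀ j, (S.boundary.restrictAbove hdS hv (R.r j)).boundary.mass ≠ ⊤) :
    S.boundary.GoodSeq hdS hv ε (fun _ => True) where
  r := R.r
  lower := R.lower
  upper := R.upper
  good := hgood
  prop _ := trivial

variable (b : OrthonormalBasis (Fin n) ℝ V) (hS : S.mass ≠ ⊤) (hdS : S.boundary.mass ≠ ⊤)
  (hsupp : IsCompact S.support) (hv : LipschitzWith 1 v) (hadm : Admissible v g C) (hC : 0 ≤ C)
  {ε : ℝ} (hε : 0 < ε) (hvε : ∀ x, v x ≤ ε)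
  (hI : ∫⁻ x, admWeight v (d + 1) x ∂S.variation ≠ ⊤)
  (hdI : ∫⁻ x, admWeight v d x ∂S.boundary.variation ≠ ⊤)

/-- **`∂ P_r(S) = P_r(∂S) − (G_r)_# ⟨S, v, r+⟩`** at a radius good for `S` and for `∂S`
(`∂ f_# = f_# ∂` for the Lipschitz push-forward and `∂(S ⌞ U_r) = (∂S) ⌞ U_r − ⟨S, v, r+⟩`).
[cite: Federer1969, 4.2.1, 4.2.2] -/
theorem Current.boundary_admPush {r : ℝ} (hr : 0 < r) (hgood : (S.restrictAbove hS hv.continuous r).boundary.mass ≠ ⊤)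
    (hgood' : (S.boundary.restrictAbove hdS hv.continuous r).boundary.mass ≠ ⊤) :
    ∃ (hm : ((S.isRepresentable_of_mass_ne_top hS).slice (S.boundary.isRepresentable_of_mass_ne_top hdS)
        hv.continuous r).mass ≠ ⊤)
      (hbm : ((S.isRepresentable_of_mass_ne_top hS).slice (S.boundary.isRepresentable_of_mass_ne_top hdS)
        hv.continuous r).boundary.mass ≠ ⊤)
      (hc : IsCompact ((S.isRepresentable_of_mass_ne_top hS).slice
        (S.boundary.isRepresentable_of_mass_ne_top hdS) hv.continuous r).support),
      (S.admPush b hS hsupp hv.continuous hadm hC hr hgood).boundary =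
        S.boundary.admPush b hdS (S.isCompact_support_boundary hsupp) hv.continuous hadm hC hr hgood' -
          ((S.isRepresentable_of_mass_ne_top hS).slice (S.boundary.isRepresentable_of_mass_ne_top hdS)
            hv.continuous r).lipPushforward hm hbm hc (hadm.lipschitzWith_ext b hC hr) ⊤ := by
  set hT := S.isRepresentable_of_mass_ne_top hS
  set hdT := S.boundary.isRepresentable_of_mass_ne_top hdS
  set X := (S.restrictAbove hS hv.continuous r).boundary with hX
  set Y := S.boundary.restrictAbove hdS hv.continuous r with hY
  set Z := hT.slice hdT hv.continuous r with hZ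
  have hYXZ : Y = X + Z := by
    simp only [hX, hY, hZ, Current.IsRepresentable.slice, Current.restrictAbove]
    abel
  -- normality data
  have hXm : X.mass ≠ ⊤ := hgood
  have hXb : X.boundary.mass ≠ ⊤ := by rw [hX, Current.boundary_boundary, Current.mass_zero]; exact ENNReal.zero_ne_top
  have hXc : IsCompact X.support :=
    (S.restrictAbove hS hv.continuous r).isCompact_support_boundary
      (S.isCompact_support_restrictAbove hS hsupp hv.continuous r)
  have hYm : Y.mass ≠ ⊤ := S.boundary.mass_restrictAbove_ne_top hdS hv.continuous r
  have hYc : IsCompact Y.support :=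
    S.boundary.isCompact_support_restrictAbove hdS (S.isCompact_support_boundary hsupp) hv.continuous r
  have hZm : Z.mass ≠ ⊤ := by
    have : Z = Y - X := by rw [hYXZ]; abel
    rw [this, sub_eq_add_neg]
    refine ne_top_of_le_ne_top (ENNReal.add_ne_top.2 ⟨hYm, ?_⟩) (Current.mass_add_le _ _)
    rwa [Current.mass_neg]
  have hZb : Z.boundary.mass ≠ ⊤ := by
    have : Z.boundary = Y.boundary - X.boundary := by rw [hYXZ, Current.boundary_add]; abel
    rw [this, sub_eq_add_neg]
    refine ne_top_of_le_ne_top (ENNReal.add_ne_top.2 ⟨hgood', ?_⟩) (Current.mass_add_le _ _)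
    rwa [Current.mass_neg]
  have hZc : IsCompact Z.support :=
    Current.isCompact_support_of_subset _ hsupp S.support_subset
      ((hT.support_slice_subset_inter hdT hv.continuous r).trans Set.inter_subset_left)
  refine ⟨hZm, hZb, hZc, ?_⟩
  -- `∂ P_r = G_# X`, `G_# Y = G_# X + G_# Z`
  have h1 := (S.restrictAbove hS hv.continuous r).boundary_lipPushforward
    (S.mass_restrictAbove_ne_top hS hv.continuous r) hgood (S.isCompact_support_restrictAbove hS hsupp hv.continuous r)
    (hadm.lipschitzWith_ext b hC hr) (Ω' := (⊤ : Opens V))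
  have h2 := Current.lipPushforward_add' (Ω' := (⊤ : Opens V)) (T₁ := X) (T₂ := Z) hXm hXb hXc hZm hZb hZc
    (by rw [← hYXZ]; exact hYm) (by rw [← hYXZ]; exact hgood') (by rw [← hYXZ]; exact hYc)
    (hadm.lipschitzWith_ext b hC hr)
  unfold Current.admPush
  rw [h1, eq_sub_iff_add_eq]
  refine h2.symm.trans ?_
  congr 1
  exact hYXZ.symm

/-- **`∂ (g_{#v} S) = g_{#v} (∂S)`** [Federer1969, 4.2.2: "`f_{#u}(∂T) = ∂ f_{#u} T`"], for any good
sequences: along a common good sequence with slice decay (`exists_goodSeq_decay`),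
`∂ P_r(S) = P_r(∂S) − (G_r)_# ⟨S, v, r+⟩` and `𝐌((G_r)_# ⟨S, v, r+⟩) ≤ (extConst r)^{d+1} 𝐌⟨S, v, r+⟩ → 0`.
[cite: Federer1969, 4.2.2] -/
theorem Current.boundary_admPushLim {P P' : ℝ → Prop} (R : S.GoodSeq hS hv.continuous ε P)
    (R' : S.boundary.GoodSeq hdS hv.continuous ε P') :
    (S.admPushLim b hS hsupp hv.continuous hadm hC hε R hvε hI).boundary =
      S.boundary.admPushLim b hdS (S.isCompact_support_boundary hsupp) hv.continuous hadm hC hε R' hvε hdI := by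
  set hT := S.isRepresentable_of_mass_ne_top hS
  set hdT := S.boundary.isRepresentable_of_mass_ne_top hdS
  -- a common good sequence with slice decay
  have hQ : ∀ᵐ r ∂(volume : Measure ℝ), (hdT.restrictSet {x | r < v x}
      (measurableSet_lt_of_continuous hv.continuous r)).boundary.mass < ⊤ :=
    hdT.ae_mass_boundary_restrictSet_lt_top (by rw [Current.boundary_boundary]; exact Current.isRepresentable_zero)
      hv hdS (by rw [Current.boundary_boundary, Current.mass_zero]; exact ENNReal.zero_ne_top)
  obtain ⟨P₀, R₀, hR₀good, hdecay⟩ := S.exists_goodSeq_decay hS hdS hv hε hI hC (n := n) hQ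
  have hgood' : ∀ j, (S.boundary.restrictAbove hdS hv.continuous (R₀.r j)).boundary.mass ≠ ⊤ :=
    fun j => (hR₀good j).ne
  set R₀' := R₀.toBoundary hdS hgood'
  rw [S.admPushLim_eq b hS hsupp hv.continuous hadm hC hε R hvε hI R₀,
    S.boundary.admPushLim_eq b hdS (S.isCompact_support_boundary hsupp) hv.continuous hadm hC hε R' hvε hdI R₀']
  ext φ
  rw [Current.boundary_apply]
  have t1 := S.tendsto_admPush b hS hsupp hv.continuous hadm hC hε R₀ hvε hI (TestForm.extDerivCLM φ)
  have t2 := S.boundary.tendsto_admPush b hdS (S.isCompact_support_boundary hsupp) hv.continuous hadm hC hε R₀' hvε hdI φ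
  -- the error terms
  choose hm hbm hc hid using fun j => S.boundary_admPush b hS hdS hsupp hv hadm hC (R₀.pos hε j) (R₀.good j) (hgood' j)
  obtain ⟨Cφ, hCφ, hφ⟩ := φ.exists_norm_le
  have herr : Tendsto (fun j => (hT.slice hdT hv.continuous (R₀.r j)).lipPushforward (hm j) (hbm j) (hc j)
      (hadm.lipschitzWith_ext b hC (R₀.pos hε j)) ⊤ φ) atTop (𝓝 0) := by
    have hmass : ∀ j, ((hT.slice hdT hv.continuous (R₀.r j)).lipPushforward (hm j) (hbm j) (hc j)
        (hadm.lipschitzWith_ext b hC (R₀.pos hε j)) ⊤).mass ≤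
        (extConst n C (R₀.r j) : ℝ≥0∞) ^ (d + 1) * (hT.slice hdT hv.continuous (R₀.r j)).mass :=
      fun j => Current.mass_lipPushforward_le _ _ _ _ _
    have hfin : ∀ j, (extConst n C (R₀.r j) : ℝ≥0∞) ^ (d + 1) * (hT.slice hdT hv.continuous (R₀.r j)).mass ≠ ⊤ :=
      fun j => ENNReal.mul_ne_top (ENNReal.pow_ne_top ENNReal.coe_ne_top) (hm j)
    have hlim : Tendsto (fun j => Cφ * ((extConst n C (R₀.r j) : ℝ≥0∞) ^ (d + 1) *
        (hT.slice hdT hv.continuous (R₀.r j)).mass).toReal) atTop (𝓝 0) := by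
      have := ((ENNReal.tendsto_toReal ENNReal.zero_ne_top).comp hdecay).const_mul Cφ
      simpa using this
    refine squeeze_zero_norm (fun j => ?_) hlim
    rw [Real.norm_eq_abs]
    refine (Current.abs_apply_le_mul_toReal_mass _ (ne_top_of_le_ne_top (hfin j) (hmass j)) hCφ hφ).trans ?_
    exact mul_le_mul_of_nonneg_left (ENNReal.toReal_mono (hfin j) (hmass j)) hCφ.le
  -- `P_j(S)(dφ) = P_j(∂S)(φ) − err_j`
  have hid' : ∀ j, S.admPush b hS hsupp hv.continuous hadm hC (R₀.pos hε j) (R₀.good j) (TestForm.extDerivCLM φ) =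
      S.boundary.admPush b hdS (S.isCompact_support_boundary hsupp) hv.continuous hadm hC (R₀.pos hε j) (hgood' j) φ -
        (hT.slice hdT hv.continuous (R₀.r j)).lipPushforward (hm j) (hbm j) (hc j)
          (hadm.lipschitzWith_ext b hC (R₀.pos hε j)) ⊤ φ := by
    intro j
    rw [← Current.boundary_apply, hid j]
    rfl
  have t2' : Tendsto (fun j => S.admPush b hS hsupp hv.continuous hadm hC (R₀.pos hε j) (R₀.good j) (TestForm.extDerivCLM φ))
      atTop (𝓝 (S.boundary.admPushLim b hdS (S.isCompact_support_boundary hsupp) hv.continuous hadm hC hε R₀' hvε hdI φ - 0)) := by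
    refine (t2.sub herr).congr fun j => (hid' j).symm.trans ?_
    rfl
  rw [sub_zero] at t2'
  exact tendsto_nhds_unique t1 t2'

end BoundaryCommutes

/-! ## Part C3: the homotopy formula for admissible push-forwards -/

section AdmissibleHomotopyFormula

open Cubical

variable {V : Type*} [NormedAddCommGroup V] [InnerProductSpace ℝ V] [FiniteDimensional ℝ V]
  [MeasurableSpace V] [BorelSpace V] {n d : ℕ} {v : V → ℝ} {g₁ g₂ : V → V} {C : ℝ}
  {S : Current (⊤ : Opens V) (d + 1 + 1)}

variable (b : OrthonormalBasis (Fin n) ℝ V) (hS : S.mass ≠ ⊤) (hdS : S.boundary.mass ≠ ⊤)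
  (hsupp : IsCompact S.support) (hv : LipschitzWith 1 v) (h₁ : Admissible v g₁ C) (h₂ : Admissible v g₂ C)
  (hC : 0 ≤ C) {η₀ : ℝ} (hη₀ : 0 ≤ η₀) (hclose : ∀ x, 0 < v x → ‖g₂ x - g₁ x‖ ≤ η₀)
  {ε : ℝ} (hε : 0 < ε) (hvε : ∀ x, v x ≤ ε)
  (hI : ∫⁻ x, admWeight v (d + 1) x ∂S.variation ≠ ⊤)
  (hdI : ∫⁻ x, admWeight v d x ∂S.boundary.variation ≠ ⊤)

/-- **The homotopy formula at a good radius**: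
`(G²_r)_# X − (G¹_r)_# X = ∂ H_r(S) + H_r(∂S) − H(G¹_r, G²_r)⟨S, v, r+⟩` with `X = S ⌞ {v > r}`
(`∂X = (∂S) ⌞ {v > r} − ⟨S, v, r+⟩`). [cite: Federer1969, 4.2.2] -/
theorem Current.admPush_sub_admPush_eq_level {r : ℝ} (hr : 0 < r)
    (hgood : (S.restrictAbove hS hv.continuous r).boundary.mass ≠ ⊤)
    (hgood' : (S.boundary.restrictAbove hdS hv.continuous r).boundary.mass ≠ ⊤) :
    ∃ (hm : ((S.isRepresentable_of_mass_ne_top hS).slice (S.boundary.isRepresentable_of_mass_ne_top hdS)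
        hv.continuous r).mass ≠ ⊤)
      (hbm : ((S.isRepresentable_of_mass_ne_top hS).slice (S.boundary.isRepresentable_of_mass_ne_top hdS)
        hv.continuous r).boundary.mass ≠ ⊤)
      (hc : IsCompact ((S.isRepresentable_of_mass_ne_top hS).slice
        (S.boundary.isRepresentable_of_mass_ne_top hdS) hv.continuous r).support),
      S.admPush b hS hsupp hv.continuous h₂ hC hr hgood - S.admPush b hS hsupp hv.continuous h₁ hC hr hgood =
        (S.admHom b hS hsupp hv.continuous h₁ h₂ hC hη₀ hclose hr hgood).boundary +
          S.boundary.admHom b hdS (S.isCompact_support_boundary hsupp) hv.continuous h₁ h₂ hC hη₀ hclose hr hgood' -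
          ((S.isRepresentable_of_mass_ne_top hS).slice (S.boundary.isRepresentable_of_mass_ne_top hdS)
            hv.continuous r).lipHomotopy hm hbm hc (h₁.lipschitzWith_ext b hC hr)
            (h₁.lipschitzWith_ext₂ b h₂ hC hη₀ hclose hr) (sqrt_mul_nonneg n hη₀)
            (h₁.norm_ext₂_sub_ext_le b h₂ hC hη₀ hclose hr) ⊤ := by
  obtain ⟨hm, hbm, hc, -⟩ := S.boundary_admPush b hS hdS hsupp hv h₁ hC hr hgood hgood'
  refine ⟨hm, hbm, hc, ?_⟩
  set hT := S.isRepresentable_of_mass_ne_top hS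
  set hdT := S.boundary.isRepresentable_of_mass_ne_top hdS
  set X := S.restrictAbove hS hv.continuous r with hX
  set Y := S.boundary.restrictAbove hdS hv.continuous r with hY
  set Z := hT.slice hdT hv.continuous r with hZ
  have hYXZ : Y = X.boundary + Z := by
    simp only [hX, hY, hZ, Current.IsRepresentable.slice, Current.restrictAbove]
    abel
  have hXm : X.mass ≠ ⊤ := S.mass_restrictAbove_ne_top hS hv.continuous r
  have hXc : IsCompact X.support := S.isCompact_support_restrictAbove hS hsupp hv.continuous r
  have hXbb : X.boundary.boundary.mass ≠ ⊤ := X.boundary_boundary_mass_ne_top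
  have hXbc : IsCompact X.boundary.support := X.isCompact_support_boundary hXc
  have hYm : Y.mass ≠ ⊤ := S.boundary.mass_restrictAbove_ne_top hdS hv.continuous r
  have hYc : IsCompact Y.support :=
    S.boundary.isCompact_support_restrictAbove hdS (S.isCompact_support_boundary hsupp) hv.continuous r
  -- (1) replace `h₂.ext` by the pair extension `ext₂` in `P_r(g₂)`
  have hP2 : S.admPush b hS hsupp hv.continuous h₂ hC hr hgood =
      X.lipPushforward hXm hgood hXc (h₁.lipschitzWith_ext₂ b h₂ hC hη₀ hclose hr) ⊤ := by
    unfold Current.admPush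
    refine X.lipPushforward_congr hXm hgood hXc (h₂.lipschitzWith_ext b hC hr)
      (h₁.lipschitzWith_ext₂ b h₂ hC hη₀ hclose hr) (N := {x | r / 2 < v x}) (isOpen_lt continuous_const hv.continuous)
      ((S.support_restrictAbove_subset hS hv.continuous r).trans fun x hx => ?_) fun x hx => ?_
    · show r / 2 < v x
      have : r ≤ v x := hx
      linarith
    · have hx' : r / 2 < v x := hx
      rw [h₂.ext_eqOn b hC hr hx'.le, h₁.ext₂_eqOn b h₂ hC hη₀ hclose hr hx'.le]
  -- (2) the Lipschitz homotopy formula for `X`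
  have hform := Current.lipPushforward_sub_lipPushforward_eq (Ω' := (⊤ : Opens V))
    (h₁.lipschitzWith_ext b hC hr) (h₁.lipschitzWith_ext₂ b h₂ hC hη₀ hclose hr) (sqrt_mul_nonneg n hη₀)
    (h₁.norm_ext₂_sub_ext_le b h₂ hC hη₀ hclose hr) X hXm hgood hXc
  -- (3) `H(Y) = H(∂X) + H(Z)`
  have hHY := Current.lipHomotopy_add (Ω' := (⊤ : Opens V)) (T₁ := X.boundary) (T₂ := Z)
    hgood hXbb hXbc hm hbm hc (by rw [← hYXZ]; exact hYm) (by rw [← hYXZ]; exact hgood') (by rw [← hYXZ]; exact hYc)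
    (h₁.lipschitzWith_ext b hC hr) (h₁.lipschitzWith_ext₂ b h₂ hC hη₀ hclose hr) (sqrt_mul_nonneg n hη₀)
    (h₁.norm_ext₂_sub_ext_le b h₂ hC hη₀ hclose hr)
  have hHY' : S.boundary.admHom b hdS (S.isCompact_support_boundary hsupp) hv.continuous h₁ h₂ hC hη₀ hclose hr hgood' =
      X.boundary.lipHomotopy hgood hXbb hXbc (h₁.lipschitzWith_ext b hC hr)
        (h₁.lipschitzWith_ext₂ b h₂ hC hη₀ hclose hr) (sqrt_mul_nonneg n hη₀)
        (h₁.norm_ext₂_sub_ext_le b h₂ hC hη₀ hclose hr) ⊤ +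
      Z.lipHomotopy hm hbm hc (h₁.lipschitzWith_ext b hC hr)
        (h₁.lipschitzWith_ext₂ b h₂ hC hη₀ hclose hr) (sqrt_mul_nonneg n hη₀)
        (h₁.norm_ext₂_sub_ext_le b h₂ hC hη₀ hclose hr) ⊤ := by
    unfold Current.admHom
    refine Eq.trans ?_ hHY
    congr 1
  rw [hP2, hHY']
  unfold Current.admPush Current.admHom
  rw [hform]
  abel

/-- **The homotopy formula for admissible push-forwards** [Federer1969, 4.2.2:
"`g_{#u} T − f_{#u} T = ∂ H_u(f,g) T + H_u(f,g) ∂T`" in case `m > 0`], for any good sequences (the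
four limits are taken along a common good sequence with slice decay, where the error term
`H(G¹_r, G²_r)⟨S, v, r+⟩` has mass `≤ √n η₀ (15 extConst r)^{d+1} 𝐌⟨S, v, r+⟩ → 0`).
[cite: Federer1969, 4.2.2] -/
theorem Current.admPushLim_sub_admPushLim_eq {P₁ P₂ P₃ P₄ : ℝ → Prop}
    (R₁ : S.GoodSeq hS hv.continuous ε P₁) (R₂ : S.GoodSeq hS hv.continuous ε P₂)
    (R₃ : S.GoodSeq hS hv.continuous ε P₃) (R₄ : S.boundary.GoodSeq hdS hv.continuous ε P₄) :
    S.admPushLim b hS hsupp hv.continuous h₂ hC hε R₂ hvε hI - S.admPushLim b hS hsupp hv.continuous h₁ hC hε R₁ hvε hI =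
      (S.admHomLim b hS hsupp hv.continuous h₁ h₂ hC hη₀ hclose hε R₃ hvε hI).boundary +
        S.boundary.admHomLim b hdS (S.isCompact_support_boundary hsupp) hv.continuous h₁ h₂ hC hη₀ hclose hε R₄ hvε hdI := by
  set hT := S.isRepresentable_of_mass_ne_top hS
  set hdT := S.boundary.isRepresentable_of_mass_ne_top hdS
  have hQ : ∀ᵐ r ∂(volume : Measure ℝ), (hdT.restrictSet {x | r < v x}
      (measurableSet_lt_of_continuous hv.continuous r)).boundary.mass < ⊤ :=
    hdT.ae_mass_boundary_restrictSet_lt_top (by rw [Current.boundary_boundary]; exact Current.isRepresentable_zero)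
      hv hdS (by rw [Current.boundary_boundary, Current.mass_zero]; exact ENNReal.zero_ne_top)
  obtain ⟨P₀, R₀, hR₀good, hdecay⟩ := S.exists_goodSeq_decay hS hdS hv hε hI hC (n := n) hQ
  have hgood' : ∀ j, (S.boundary.restrictAbove hdS hv.continuous (R₀.r j)).boundary.mass ≠ ⊤ :=
    fun j => (hR₀good j).ne
  set R₀' := R₀.toBoundary hdS hgood'
  rw [S.admPushLim_eq b hS hsupp hv.continuous h₂ hC hε R₂ hvε hI R₀,
    S.admPushLim_eq b hS hsupp hv.continuous h₁ hC hε R₁ hvε hI R₀,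
    S.admHomLim_eq b hS hsupp hv.continuous h₁ h₂ hC hη₀ hclose hε R₃ hvε hI R₀,
    S.boundary.admHomLim_eq b hdS (S.isCompact_support_boundary hsupp) hv.continuous h₁ h₂ hC hη₀ hclose hε R₄ hvε hdI R₀']
  ext φ
  have t1 := S.tendsto_admPush b hS hsupp hv.continuous h₂ hC hε R₀ hvε hI φ
  have t2 := S.tendsto_admPush b hS hsupp hv.continuous h₁ hC hε R₀ hvε hI φ
  have t3 := S.tendsto_admHom b hS hsupp hv.continuous h₁ h₂ hC hη₀ hclose hε R₀ hvε hI (TestForm.extDerivCLM φ)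
  have t4 := S.boundary.tendsto_admHom b hdS (S.isCompact_support_boundary hsupp) hv.continuous h₁ h₂ hC hη₀ hclose
    hε R₀' hvε hdI φ
  choose hm hbm hc hid using fun j => S.admPush_sub_admPush_eq_level b hS hdS hsupp hv h₁ h₂ hC hη₀ hclose
    (R₀.pos hε j) (R₀.good j) (hgood' j)
  obtain ⟨Cφ, hCφ, hφ⟩ := φ.exists_norm_le
  -- the error term tends to `0`
  have herr : Tendsto (fun j => (hT.slice hdT hv.continuous (R₀.r j)).lipHomotopy (hm j) (hbm j) (hc j)
      (h₁.lipschitzWith_ext b hC (R₀.pos hε j)) (h₁.lipschitzWith_ext₂ b h₂ hC hη₀ hclose (R₀.pos hε j))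
      (sqrt_mul_nonneg n hη₀) (h₁.norm_ext₂_sub_ext_le b h₂ hC hη₀ hclose (R₀.pos hε j)) ⊤ φ) atTop (𝓝 0) := by
    set K : ℝ≥0∞ := ENNReal.ofReal (Real.sqrt n * η₀ * 15 ^ (d + 1)) with hK
    have hmass : ∀ j, ((hT.slice hdT hv.continuous (R₀.r j)).lipHomotopy (hm j) (hbm j) (hc j)
        (h₁.lipschitzWith_ext b hC (R₀.pos hε j)) (h₁.lipschitzWith_ext₂ b h₂ hC hη₀ hclose (R₀.pos hε j))
        (sqrt_mul_nonneg n hη₀) (h₁.norm_ext₂_sub_ext_le b h₂ hC hη₀ hclose (R₀.pos hε j)) ⊤).mass ≤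
        K * ((extConst n C (R₀.r j) : ℝ≥0∞) ^ (d + 1) * (hT.slice hdT hv.continuous (R₀.r j)).mass) := by
      intro j
      refine (Current.mass_lipHomotopy_le _ _ _ _ _ _ _ _).trans ?_
      rw [← mul_assoc]
      refine mul_le_mul' (le_of_eq ?_) le_rfl
      have he : max ((extConst n C (R₀.r j) : ℝ≥0) : ℝ) ((3 * extConst n C (R₀.r j) : ℝ≥0) : ℝ) =
          3 * (extConst n C (R₀.r j) : ℝ) := by
        push_cast
        exact max_eq_right (by linarith [(extConst n C (R₀.r j)).coe_nonneg])
      rw [he, show 5 * (3 * (extConst n C (R₀.r j) : ℝ)) = 15 * (extConst n C (R₀.r j) : ℝ) by ring, mul_pow,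
        ← mul_assoc, ENNReal.ofReal_mul (by positivity), hK, ENNReal.ofReal_pow (extConst n C (R₀.r j)).coe_nonneg,
        ENNReal.ofReal_coe_nnreal]
    have hKfin : K ≠ ⊤ := ENNReal.ofReal_ne_top
    have hfin : ∀ j, K * ((extConst n C (R₀.r j) : ℝ≥0∞) ^ (d + 1) * (hT.slice hdT hv.continuous (R₀.r j)).mass) ≠ ⊤ :=
      fun j => ENNReal.mul_ne_top hKfin (ENNReal.mul_ne_top (ENNReal.pow_ne_top ENNReal.coe_ne_top) (hm j))
    have hlim : Tendsto (fun j => Cφ * (K * ((extConst n C (R₀.r j) : ℝ≥0∞) ^ (d + 1) *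
        (hT.slice hdT hv.continuous (R₀.r j)).mass)).toReal) atTop (𝓝 0) := by
      have h0 : Tendsto (fun j => K * ((extConst n C (R₀.r j) : ℝ≥0∞) ^ (d + 1) *
          (hT.slice hdT hv.continuous (R₀.r j)).mass)) atTop (𝓝 0) := by
        have := ENNReal.Tendsto.const_mul (a := K) hdecay (Or.inr hKfin)
        rwa [mul_zero] at this
      have := ((ENNReal.tendsto_toReal ENNReal.zero_ne_top).comp h0).const_mul Cφ
      simpa using this
    refine squeeze_zero_norm (fun j => ?_) hlim
    rw [Real.norm_eq_abs]
    refine (Current.abs_apply_le_mul_toReal_mass _ (ne_top_of_le_ne_top (hfin j) (hmass j)) hCφ hφ).trans ?_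
    exact mul_le_mul_of_nonneg_left (ENNReal.toReal_mono (hfin j) (hmass j)) hCφ.le
  have hid' : ∀ j, S.admPush b hS hsupp hv.continuous h₂ hC (R₀.pos hε j) (R₀.good j) φ -
      S.admPush b hS hsupp hv.continuous h₁ hC (R₀.pos hε j) (R₀.good j) φ =
      S.admHom b hS hsupp hv.continuous h₁ h₂ hC hη₀ hclose (R₀.pos hε j) (R₀.good j) (TestForm.extDerivCLM φ) +
        S.boundary.admHom b hdS (S.isCompact_support_boundary hsupp) hv.continuous h₁ h₂ hC hη₀ hclose
          (R₀.pos hε j) (hgood' j) φ -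
        (hT.slice hdT hv.continuous (R₀.r j)).lipHomotopy (hm j) (hbm j) (hc j)
          (h₁.lipschitzWith_ext b hC (R₀.pos hε j)) (h₁.lipschitzWith_ext₂ b h₂ hC hη₀ hclose (R₀.pos hε j))
          (sqrt_mul_nonneg n hη₀) (h₁.norm_ext₂_sub_ext_le b h₂ hC hη₀ hclose (R₀.pos hε j)) ⊤ φ := by
    intro j
    have := DFunLike.congr_fun (hid j) φ
    rw [← Current.boundary_apply]
    exact this
  have lhs := t1.sub t2
  have rhs := (t3.add t4).sub herr
  rw [sub_zero] at rhs
  have := tendsto_nhds_unique (lhs.congr fun j => hid' j) rhs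
  rw [show (S.admPushLim b hS hsupp hv.continuous h₂ hC hε R₀ hvε hI - S.admPushLim b hS hsupp hv.continuous h₁ hC hε R₀ hvε hI) φ
      = S.admPushLim b hS hsupp hv.continuous h₂ hC hε R₀ hvε hI φ - S.admPushLim b hS hsupp hv.continuous h₁ hC hε R₀ hvε hI φ
      from rfl, this]
  rfl

end AdmissibleHomotopyFormula

/-! ## Part C4: independence of the control function -/

section ControlMonotone

open Cubical

variable {V : Type*} [NormedAddCommGroup V] [InnerProductSpace ℝ V] [FiniteDimensional ℝ V]
  [MeasurableSpace V] [BorelSpace V] {n d : ℕ} {v v' : V → ℝ} {g : V → V} {C : ℝ}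
  {S : Current (⊤ : Opens V) (d + 1)}

omit [NormedAddCommGroup V] [InnerProductSpace ℝ V] [FiniteDimensional ℝ V] [MeasurableSpace V] [BorelSpace V] in
/-- The weight is antitone in the control function. [folklore] -/
theorem admWeight_mono (hvv' : ∀ x, v x ≤ v' x) (x : V) : admWeight v' d x ≤ admWeight v d x := by
  unfold admWeight
  gcongr
  exact hvv' x

/-- A good sequence for `v` whose radii are good for `v'` is a good sequence for `v'`. [folklore] -/
def Current.GoodSeq.toControl {hS : S.mass ≠ ⊤} {hv : Continuous v} {ε : ℝ} {P : ℝ → Prop}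
    (R : S.GoodSeq hS hv ε P) (hv' : Continuous v')
    (hgood : ∀ j, (S.restrictAbove hS hv' (R.r j)).boundary.mass ≠ ⊤) : S.GoodSeq hS hv' ε (fun _ => True) where
  r := R.r
  lower := R.lower
  upper := R.upper
  good := hgood
  prop _ := trivial

variable (b : OrthonormalBasis (Fin n) ℝ V) (hS : S.mass ≠ ⊤) (hdS : S.boundary.mass ≠ ⊤)
  (hsupp : IsCompact S.support) (hv : LipschitzWith 1 v) (hv' : LipschitzWith 1 v') (hvv' : ∀ x, v x ≤ v' x)
  (hadm : Admissible v g C) (hadm' : Admissible v' g C) (hC : 0 ≤ C)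
  {ε : ℝ} (hε : 0 < ε) (hvε : ∀ x, v x ≤ ε) (hvε' : ∀ x, v' x ≤ ε)
  (hI : ∫⁻ x, admWeight v d x ∂S.variation ≠ ⊤) (hI' : ∫⁻ x, admWeight v' d x ∂S.variation ≠ ⊤)

include hvv' in
/-- **Comparison at a common good radius**: `P'_r − P_r = (G'_r)_# (S ⌞ {v ≤ r < v'})`, of mass
`≤ (extConst r)^{d+1} ‖S‖{v ≤ r}`. [cite: Federer1969, 4.2.2] -/
theorem Current.mass_admPush_control_sub_le {r : ℝ} (hr : 0 < r)
    (hgood : (S.restrictAbove hS hv.continuous r).boundary.mass ≠ ⊤)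
    (hgood' : (S.restrictAbove hS hv'.continuous r).boundary.mass ≠ ⊤) :
    (S.admPush b hS hsupp hv'.continuous hadm' hC hr hgood' - S.admPush b hS hsupp hv.continuous hadm hC hr hgood).mass ≤
      (extConst n C r : ℝ≥0∞) ^ (d + 1) * S.variation {x | v x ≤ r} := by
  set hT := S.isRepresentable_of_mass_ne_top hS
  have hDm : MeasurableSet {x | r < v' x ∧ v x ≤ r} :=
    (measurableSet_lt_of_continuous hv'.continuous r).inter (isClosed_le hv.continuous continuous_const).measurableSet
  set X := S.restrictAbove hS hv.continuous r with hX
  set X' := S.restrictAbove hS hv'.continuous r with hX'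
  set D := hT.restrictSet {x | r < v' x ∧ v x ≤ r} hDm with hD
  have hunion : X' = X + D := by
    simp only [hX, hX', hD, Current.restrictAbove]
    rw [← hT.restrictSet_union]
    · congr 1
      ext x
      simp only [Set.mem_setOf_eq, Set.mem_union]
      constructor
      · intro h
        by_cases h' : r < v x
        · exact Or.inl h'
        · exact Or.inr ⟨h, not_lt.1 h'⟩
      · rintro (h | h)
        · exact lt_of_lt_of_le h (hvv' x)
        · exact h.1
    · exact Set.disjoint_left.2 fun x (hx : r < v x) hx' => (not_le.2 hx) hx'.2
  have hXm : X.mass ≠ ⊤ := S.mass_restrictAbove_ne_top hS hv.continuous r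
  have hXc : IsCompact X.support := S.isCompact_support_restrictAbove hS hsupp hv.continuous r
  have hX'm : X'.mass ≠ ⊤ := S.mass_restrictAbove_ne_top hS hv'.continuous r
  have hX'c : IsCompact X'.support := S.isCompact_support_restrictAbove hS hsupp hv'.continuous r
  have hDm' : D.mass ≠ ⊤ := Current.mass_restrictSet_ne_top' _ hS _
  have hDb : D.boundary.mass ≠ ⊤ := by
    have : D = X' + -X := by rw [hunion]; abel
    rw [this, Current.boundary_add, Current.boundary_neg]
    refine ne_top_of_le_ne_top (ENNReal.add_ne_top.2 ⟨hgood', ?_⟩) (Current.mass_add_le _ _)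
    rwa [Current.mass_neg]
  have hDc : IsCompact D.support :=
    Current.isCompact_support_of_subset _ hsupp S.support_subset (hT.support_restrictSet_subset _)
  -- `P'_r = (G'_r)_# X + (G'_r)_# D` and `(G'_r)_# X = (G_r)_# X`
  have hadd := Current.lipPushforward_add' (Ω' := (⊤ : Opens V)) (T₁ := X) (T₂ := D) hXm hgood hXc hDm' hDb hDc
    (by rw [← hunion]; exact hX'm) (by rw [← hunion]; exact hgood') (by rw [← hunion]; exact hX'c)
    (hadm'.lipschitzWith_ext b hC hr)
  have hcongr : X.lipPushforward hXm hgood hXc (hadm'.lipschitzWith_ext b hC hr) ⊤ =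
      X.lipPushforward hXm hgood hXc (hadm.lipschitzWith_ext b hC hr) ⊤ := by
    refine X.lipPushforward_congr hXm hgood hXc (hadm'.lipschitzWith_ext b hC hr) (hadm.lipschitzWith_ext b hC hr)
      (N := {x | r / 2 < v x}) (isOpen_lt continuous_const hv.continuous)
      ((S.support_restrictAbove_subset hS hv.continuous r).trans fun x hx => ?_) fun x hx => ?_
    · show r / 2 < v x
      have : r ≤ v x := hx
      linarith
    · have hx1 : r / 2 < v x := hx
      rw [hadm.ext_eqOn b hC hr hx1.le, hadm'.ext_eqOn b hC hr (show r / 2 ≤ v' x from hx1.le.trans (hvv' x))]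
  have hP' : S.admPush b hS hsupp hv'.continuous hadm' hC hr hgood' =
      X.lipPushforward hXm hgood hXc (hadm.lipschitzWith_ext b hC hr) ⊤ +
        D.lipPushforward hDm' hDb hDc (hadm'.lipschitzWith_ext b hC hr) ⊤ := by
    rw [← hcongr, ← hadd]
    unfold Current.admPush
    congr 1
  have hP : S.admPush b hS hsupp hv.continuous hadm hC hr hgood =
      X.lipPushforward hXm hgood hXc (hadm.lipschitzWith_ext b hC hr) ⊤ := rfl
  rw [hP', hP, add_sub_cancel_left]
  refine (Current.mass_lipPushforward_le _ _ hDb _ _).trans (mul_le_mul' le_rfl ?_)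
  exact (hT.mass_restrictSet_le hDm).trans (measure_mono fun x hx => hx.2)

include hdS hvv' hI in
/-- **Independence of the control function** [Federer1969, 4.2.2, 4.2.9: `(σ_m ∘ τ_a)` is both
`v`- and `w`-admissible]: if `v ≤ v'` are two admissible control functions for `g`, then
`g_{#v} S = g_{#v'} S` (along a common good sequence, `𝐌(P'_r − P_r) ≤ (extConst r)^{d+1} ‖S‖{v ≤ r}
≤ (8C√n)^{d+1} ∫_{v ≤ r} (1/v)^{d+1} d‖S‖ → 0`). [cite: Federer1969, 4.2.2] -/
theorem Current.admPushLim_control_eq {P P' : ℝ → Prop} (R : S.GoodSeq hS hv.continuous ε P)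
    (R' : S.GoodSeq hS hv'.continuous ε P') :
    S.admPushLim b hS hsupp hv.continuous hadm hC hε R hvε hI =
      S.admPushLim b hS hsupp hv'.continuous hadm' hC hε R' hvε' hI' := by
  set hT := S.isRepresentable_of_mass_ne_top hS
  set hdT := S.boundary.isRepresentable_of_mass_ne_top hdS
  -- a common good sequence
  have hQ : ∀ᵐ r ∂(volume : Measure ℝ),
      (hT.restrictSet {x | r < v' x} (measurableSet_lt_of_continuous hv'.continuous r)).boundary.mass < ⊤ :=
    hT.ae_mass_boundary_restrictSet_lt_top hdT hv' hS hdS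
  obtain ⟨R₀⟩ := S.exists_goodSeq hS hdS hv hε hQ
  have hgood' : ∀ j, (S.restrictAbove hS hv'.continuous (R₀.r j)).boundary.mass ≠ ⊤ := fun j => (R₀.prop j).ne
  set R₀' := R₀.toControl hv'.continuous hgood'
  rw [S.admPushLim_eq b hS hsupp hv.continuous hadm hC hε R hvε hI R₀,
    S.admPushLim_eq b hS hsupp hv'.continuous hadm' hC hε R' hvε' hI' R₀']
  ext φ
  have t1 := S.tendsto_admPush b hS hsupp hv.continuous hadm hC hε R₀ hvε hI φ
  have t2 := S.tendsto_admPush b hS hsupp hv'.continuous hadm' hC hε R₀' hvε' hI' φ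
  obtain ⟨Cφ, hCφ, hφ⟩ := φ.exists_norm_le
  -- masses of the differences
  have h0 : S.variation {x | v x ≤ 0} = 0 := by
    by_contra hne
    apply hI
    refine eq_top_iff.2 (le_trans ?_ (setLIntegral_le_lintegral {x | v x ≤ 0} _))
    have : ∫⁻ x in {x | v x ≤ 0}, admWeight v d x ∂S.variation = ∫⁻ _ in {x | v x ≤ 0}, ⊤ ∂S.variation :=
      setLIntegral_congr_fun (isClosed_le hv.continuous continuous_const).measurableSet fun x hx => admWeight_eq_top hx
    rw [this, setLIntegral_const, ENNReal.top_mul hne]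
  have hmass : ∀ j, (S.admPush b hS hsupp hv'.continuous hadm' hC (R₀'.pos hε j) (R₀'.good j) -
      S.admPush b hS hsupp hv.continuous hadm hC (R₀.pos hε j) (R₀.good j)).mass ≤
      admConst n C d * ∫⁻ x in {x | v x ≤ ε / 2 ^ j}, admWeight v d x ∂S.variation := by
    intro j
    refine (S.mass_admPush_control_sub_le b hS hsupp hv hv' hvv' hadm hadm' hC (R₀.pos hε j) (R₀.good j) (hgood' j)).trans ?_
    have hsplit : S.variation {x | v x ≤ R₀.r j} = S.variation {x | 0 < v x ∧ v x ≤ R₀.r j} := by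
      refine le_antisymm ?_ (measure_mono fun x hx => hx.2)
      calc S.variation {x | v x ≤ R₀.r j} ≤ S.variation ({x | 0 < v x ∧ v x ≤ R₀.r j} ∪ {x | v x ≤ 0}) :=
            measure_mono fun x (hx : v x ≤ R₀.r j) => by
              by_cases h : 0 < v x
              · exact Or.inl ⟨h, hx⟩
              · exact Or.inr (not_lt.1 h)
        _ ≤ S.variation {x | 0 < v x ∧ v x ≤ R₀.r j} + S.variation {x | v x ≤ 0} := measure_union_le _ _
        _ = S.variation {x | 0 < v x ∧ v x ≤ R₀.r j} := by rw [h0, add_zero]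
    rw [hsplit]
    have hmeas : MeasurableSet {x | 0 < v x ∧ v x ≤ R₀.r j} :=
      (measurableSet_lt_of_continuous hv.continuous 0).inter (isClosed_le hv.continuous continuous_const).measurableSet
    calc (extConst n C (R₀.r j) : ℝ≥0∞) ^ (d + 1) * S.variation {x | 0 < v x ∧ v x ≤ R₀.r j}
        = ∫⁻ _ in {x | 0 < v x ∧ v x ≤ R₀.r j}, (extConst n C (R₀.r j) : ℝ≥0∞) ^ (d + 1) ∂S.variation :=
          (setLIntegral_const _ _).symm
      _ ≤ ∫⁻ x in {x | 0 < v x ∧ v x ≤ R₀.r j}, admConst n C d * admWeight v d x ∂S.variation :=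
          setLIntegral_mono (measurable_const.mul (measurable_admWeight hv.continuous)) fun x hx =>
            extConst_pow_le_admConst_mul hC (R₀.pos hε j) hx.1 (by linarith [hx.2, R₀.pos hε j])
      _ = admConst n C d * ∫⁻ x in {x | 0 < v x ∧ v x ≤ R₀.r j}, admWeight v d x ∂S.variation :=
          lintegral_const_mul _ (measurable_admWeight hv.continuous)
      _ ≤ admConst n C d * ∫⁻ x in {x | v x ≤ ε / 2 ^ j}, admWeight v d x ∂S.variation :=
          mul_le_mul' le_rfl (lintegral_mono_set fun x hx => hx.2.trans (R₀.upper j))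
  have hne : ∀ j, admConst n C d * ∫⁻ x in {x | v x ≤ ε / 2 ^ j}, admWeight v d x ∂S.variation ≠ ⊤ := fun j =>
    ENNReal.mul_ne_top admConst_ne_top (ne_top_of_le_ne_top hI (setLIntegral_le_lintegral _ _))
  have hlim0 : Tendsto (fun j => admConst n C d * ∫⁻ x in {x | v x ≤ ε / 2 ^ j}, admWeight v d x ∂S.variation)
      atTop (𝓝 0) := by
    have hsub := tendsto_setLIntegral_zero (μ := S.variation) hI
      (s := fun j : ℕ => {x | v x ≤ ε / 2 ^ j}) (S.tendsto_variation_sublevel_of_null hS hv.continuous hε h0)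
    have := ENNReal.Tendsto.const_mul (a := admConst n C d) hsub (Or.inr admConst_ne_top)
    rwa [mul_zero] at this
  have hlim : Tendsto (fun j => Cφ * (admConst n C d *
      ∫⁻ x in {x | v x ≤ ε / 2 ^ j}, admWeight v d x ∂S.variation).toReal) atTop (𝓝 0) := by
    have := ((ENNReal.tendsto_toReal ENNReal.zero_ne_top).comp hlim0).const_mul Cφ
    simpa using this
  have hdiff : Tendsto (fun j => S.admPush b hS hsupp hv'.continuous hadm' hC (R₀'.pos hε j) (R₀'.good j) φ -
      S.admPush b hS hsupp hv.continuous hadm hC (R₀.pos hε j) (R₀.good j) φ) atTop (𝓝 0) := by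
    refine squeeze_zero_norm (fun j => ?_) hlim
    rw [Real.norm_eq_abs]
    have hfin := ne_top_of_le_ne_top (hne j) (hmass j)
    have := Current.abs_apply_le_mul_toReal_mass _ hfin hCφ hφ (φ := φ)
    refine (by simpa using this : |S.admPush b hS hsupp hv'.continuous hadm' hC (R₀'.pos hε j) (R₀'.good j) φ -
      S.admPush b hS hsupp hv.continuous hadm hC (R₀.pos hε j) (R₀.good j) φ| ≤ _).trans ?_
    exact mul_le_mul_of_nonneg_left (ENNReal.toReal_mono (hne j) (hmass j)) hCφ.le
  have := hdiff.add t1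
  simp only [zero_add, sub_add_cancel] at this
  exact (tendsto_nhds_unique this t2).symm ▸ rfl

end ControlMonotone

end Literature.Geometry.GeometricMeasureTheory
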